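import Literature.MathematicalPhysics.QuantumFieldTheory.Balaban1983to89.B6GlobalChartV1
import Literature.MathematicalPhysics.QuantumFieldTheory.Balaban1983to89.B6Eq2129TwoScaleV1

/-!
# `Balaban1983to89.B6AgreeLapV1Chart` — T. Bałaban, *Propagators and renormalization transformations for lattice gauge theories. II*, Commun.
# Math. Phys. **96** (1984) 223–250 [Balaban1984PropagatorsII], pp. 238–239: THE LOCAL OPERATORS OF `T_□` AGREE WITH THE GLOBAL ONES NEAR `□`
# — item (d3-a) of the B6 fold owner's programme for the genuine k-level Proposition 2.6 (B6-CLOSURE.md §5 items 7–9): a generic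
# CHART-AGREEMENT CALCULUS for stencils read through a bijective window chart, the V1 window charts (sites, bonds, plaquettes), and the
# theorem that the vector Laplacian `Δ = ∂*∂ + ∂∂*` of the global torus `T_η`, cut off near `□`, IS the transplanted `Δ_□` of the member torus
# `T_□` up to the unit factor `(c′/c)²`; plus the two cheap hypotheses `hΔ`, `hinvl` of `B6GlobalChartV1.prop26_2136_V1_of_2134_eq291` DISCHARGED

statement-level skeleton of published theorems with citation tags; proofs where landed; nothing here is a claim about the Yang–Mills mass gap

PDF held: `paper:balaban1984-cmp96-propagators-rt-ii` (journal page = PDF page + 222); pp. 238–239 [PDF 16–17] re-read this generation (text layer +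
the b2b-balaban ref1 renders).  PRINT (verbatim, p. 238–239): *"We take the cube □̃³ and identify it with a torus, denoted by T_□, imposing
periodicity conditions. On this torus we define operators R, Δ_a as in (2.17), (2.19), but only two scales are present now. We define
B^j(Λ′) = □̃² ∩ B^{j+1}(Λ_{j+1}), (2.89) and we take Q′*aQ′, Q*aQ equal to Q′_{j+1}a_{j+1}Q′_{j+1}, Q_{j+1}a_{j+1}Q_{j+1} on B^j(Λ′), and to Q_j*a_jQ_j,
Q′_j*a_jQ′_j on T_□ ∖ B^j(Λ′) … G_□ = (Δ − ∂P_□∂* + Q*aQ)⁻¹. (2.90) Both operators are defined on the torus T_□. We form an approximation of G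
taking as usual G₀ = Σ_{□∈𝒟} h_□G_□h_□"*; (2.94) p. 239 (the rescaling `η ↔ ξ = L^{−j}`).

CITATION HEADER (lean-in-tree rule) — WHAT IS REPRODUCED.  Phase-2 file of the `lit-balaban` typed skeleton (HOME `run/shared/lean/pub/lit-balaban/`),
unit `lit-balaban-r03` (B6 fold owner; r03 gen 19, literature-prover-lit-balaban-r03-g19-0), referee ref-4.  SKELETON rows **B6.Eq2.90** × **B6.Eq2.91** ×
**B6.Prop2.6** (cells; decls of record untouched).  The assembled implication of record `B6GlobalChartV1.prop26_2136_V1_of_2134_eq291` (r03 gen 18,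
p343954) derives Proposition 2.6 (2.136)₁ on the V1 global torus from the RING DATA of (2.91): among them `hΔ : Δ_a = M − ∂P∂*`, the AGREEMENT
`hagree : M·h_□ = M_□·h_□` of the local part `M = Δ + Q*aQ` of the global `Δ_a` with the member's operator on the cut-off `h_□`, and the INVERSION
`hinvl : (M_□ − P_□)G_□h_□ = h_□`.  This file proves `hΔ` and `hinvl` outright and the `Δ`-HALF of `hagree` (the averaging half `Q*aQ` — which needs
the correspondence of the index sets `𝔅 ∩ □̃` of (2.89) — is the sibling (d3-b) `B6AgreeQaQV1Chart`).  IMPORTS BY NAME, restating nothing: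
`B6GlobalChartV1` (`PV`, `GlV1`, `toBox`), `B6Prop26ReachTransplant` (`restrictOp`/`extendOp`/`transplant`, `chartBond`, `siteOfInt`, §9
`transplant_inv_mul_mulOp`/`transplant_sub`), `B6SectAOperatorsV1` (`dE`, `dsE`, `dcE`, `dcsE := (dcE)†`, `dsE_eq_adjoint`, `QE`/`QsE`/`aE`/`RE`),
`B6SectAVectorModelV1.deltaAE` (2.19), `B6Ineq2133TwoScaleV1.onFun`, `B6Prop25TwoScaleCensus.TSIdx` (the member; `t.D = tsV1 …`),
`B6Eq2129TwoScaleV1.deltaA_comp_G_V1` (`Δ_□G_□ = 1` on `T_□`), Mathlib's `LinearMap.toMatrix'`, `LinearMap.adjoint`, `EuclideanSpace.single`.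

THIS FILE (0 sorry; standard axioms; no `def … : Prop`, no new hypothesis-shaped fact; 5 structures/defs WITH BODIES: `WChart`, `KAgree`, `KLocal`,
`posV`, `eS`/`eB`/`eP`, `DeepS`/`DeepB`/`DeepP`, `cS`/`cB`/`cP`, one `DecidableEq (Plaq P j)` instance).
* §1 kernels: `apply_eq_sum_toMatrix`, `toMatrix'_comp_apply`, `adjoint_single_apply`, **`toMatrix'_onFun_adjoint`** (the matrix of the bond-function
  reading of an `ℓ²`-adjoint is the transpose), `onFun_comp/add/sub/smul/id`.
* §2 THE GENERIC CHART-AGREEMENT CALCULUS: `WChart X X′` (window `W`, chart `e`, injective on `W`, onto `X′`; `WChart.sum_eq`), **`KAgree cI cO s T T′ R`**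
  (for inputs `x ∈ R`: the global kernel `T(y,x)` is `s·T′(e y, e x)` on window outputs and `0` off the window), `KLocal T R₁ R₂`; **`KAgree.comp`**
  (factors multiply; the middle deep set is where the first stencil lands), `KAgree.add/smul/smul_right/mono`, **`KAgree.transpose`** (adjoint pairs,
  given the two reverse localities), `KLocal.mono/add/comp`, and **`KAgree.mul_mulOp`**: `KAgree c c s T T′ R` ⟹ `T·h = s•(εT′ρ)·h` for every `h`
  supported in `R` — the SHAPE of `hagree`; `restrictOp_congr`, `transplant_congr` (charts agreeing on the window transplant alike).
* §3 THE V1 WINDOW CHARTS for a member `t : TSIdx` and a corner `x₀ ≥ 0` with the full window `[x₀, x₀ + 2L^{m_□+K_□})^{d+1}` inside the fundamental box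
  (`hfit`): `eS` (labels minus corner, `Int.cast` into `ZMod`), `eB`, `eP`; `DeepS/DeepB/DeepP r` (margin `r`); `deepS_mono`, `shift_mem_deepS`,
  `unshift_mem_deepS`, **`eS_shift`/`eS_unshift`** (the chart intertwines `x ↦ x ± e_μ` on margin-1 sites), `val_eS`, `eS_injOn`, **`eS_surj`**,
  `eS_eq_siteOfInt`, `eB_eq_chartBond` (on the window `eB` IS `B6Prop26ReachTransplant.chartBond t (labels) dir x₀`).
* §4 `cS/cB/cP` (the three `WChart`s), `eS_eq_iff`, `eS_shift_eq_iff(′)`; the kernels `toMatrix'_dE` (`c([b₊=x] − [b₋=x])`), `toMatrix'_dcE` (the four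
  bonds of `∂p`), `toMatrix'_dsE`/`toMatrix'_dcsE` (transposes); `dE_ne_zero_cases`, `dcE_ne_zero_cases`; **`kagree_dE`** (sites → bonds, margin 1,
  factor `c′/c`), **`kagree_dcE`** (bonds → plaquettes, margin 1), `klocal_dE/dsE/dcE/dcsE`, **`kagree_dsE`** (margin 2), **`kagree_dcsE`** (margin 2).
* §5 **`kagree_lapV`** (margin 3, factor `(c′/c)²`), **`agree_lapV`**: `onFun (∂*∂ + ∂∂*)_{c′} * mulOp h = (c′/c)² • (transplant W eB (onFun (∂*∂ + ∂∂*)_c) * mulOp h)`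
  for `supp h ⊂ DeepB 3`; `lapV_member` (`t.D.lapV` IS the V1 formula at `c = L^j`), `transplant_eB_eq`, `GlV1_eq`, **`agree_lapV_member`** (the same with
  the member's own `Δ_□ = t.D.lapV` along `chartBond`, factor `(c′/L^j)²`).
* §6 **`deltaAE_split`** (`hΔ`: `onFun (deltaAE D c w) = onFun (∂*∂ + ∂∂* + Q*aQ) − onFun (∂(I − R)∂*)`), `deltaA_member`, `onFun_deltaA_mul_G`,
  **`hinvl_member`** / **`hinvl_GlV1`** (`hinvl` of `prop26_2136_V1_of_2134_eq291` LITERALLY, for `Ml := ε(Δ_□ + Q*aQ)ρ`, `Pl := ε(∂P_□∂*)ρ`, `GlV1` on the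
  full bond window, every `a₀ > 0` and every `h` supported in the window).

HONEST SCOPE / DIVERGENCES. (1) The window is the FULL period `2L^{m_□+K_□}` of the member torus placed inside the fundamental box of `T_η` with
`x₀ ≥ 0` (no wrap of the global torus inside the window; windows across the seam of `T_η` are not treated here — translate the torus first);
`T_□ ⊇ □̃³` is a V1 torus of side `2L^{n}`, not exactly print's `□̃³` (as in `B6Prop26ReachTransplant`, honest scope (8)). (2) UNITS: the member's
fine factor is `c = L^{j(□)}` (`TSIdx`), the global one `c′` is free; the agreement carries `(c′/c)²`.  For the §5 assembly of `B6GlobalChartV1`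
(unscaled `GlV1`, weight `P ≡ 1`) the `Δ`-part of `hagree` is this theorem with factor `1`, i.e. for members of ONE scale `j` with `c′ = L^j`; the
genuine multi-scale assembly (d5) must carry the factor (members `(L^j/c′)²•GlV1`, prefactor `(L^jη)²` as printed in (2.136)) — recorded as a design
finding, not claimed here. (3) Only the `Δ`-part of the local operator is treated; `Q*aQ` (index sets `Λ_j`, `Λ_{j+1}` near `□` ↔ the member's
`Λ^c ⊔ Λ′` of (2.89)/(2.97), equal weights up to `(c′/c)²`) is (d3-b). (4) `hinvl` is discharged for EVERY window-supported `h` (no margin), `hΔ` for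
every V1 `Domains`/factor/weights.  Value = typed skeleton + proofs of two of the five ring hypotheses of (2.91) and half of a third; NOT summit progress.
-/

noncomputable section

open scoped BigOperators Matrix
open Finset

namespace Literature.MathematicalPhysics.QuantumFieldTheory.Balaban1983to89.B6AgreeLapV1Chart

open B6Prop26Gluing (mulOp mulOp_apply)
open B6Prop26ReachTransplant (restrictOp extendOp transplant restrictOp_apply restrictOp_apply_of_injOn transplant_apply)

/-! ## §1  Kernels (matrices) of linear maps of function spaces; the transpose of an adjoint -/

section Kernels

variable {Xi Xo Xm : Type}

/-- `(Tf)(y) = Σ_x T(y,x) f(x)` — a linear map of function spaces IS its matrix (`LinearMap.toMatrix'`). [cite: Balaban1984PropagatorsII, (2.150) p.249 (operators as kernels), dictionary] -/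
theorem apply_eq_sum_toMatrix [Fintype Xi] [DecidableEq Xi] (T : (Xi → ℝ) →ₗ[ℝ] (Xo → ℝ)) (f : Xi → ℝ) (y : Xo) :
    T f y = ∑ x, LinearMap.toMatrix' T y x * f x := by
  have h := congrFun (LinearMap.toMatrix'_mulVec T f) y
  rw [← h]
  rfl

/-- entries of a composite: `(T₂T₁)(y,x) = Σ_z T₂(y,z)T₁(z,x)`. [cite: Balaban1984PropagatorsII, (2.150) p.249 (operators as kernels), dictionary] -/
theorem toMatrix'_comp_apply [Fintype Xi] [DecidableEq Xi] [Fintype Xm] [DecidableEq Xm] (T₂ : (Xm → ℝ) →ₗ[ℝ] (Xo → ℝ)) (T₁ : (Xi → ℝ) →ₗ[ℝ] (Xm → ℝ)) (y : Xo) (x : Xi) :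
    LinearMap.toMatrix' (T₂ ∘ₗ T₁) y x = ∑ z, LinearMap.toMatrix' T₂ y z * LinearMap.toMatrix' T₁ z x := by
  rw [LinearMap.toMatrix'_comp, Matrix.mul_apply]

end Kernels

section Adjoint

open B6Ineq2133TwoScaleV1 (onFun onFun_apply)

variable {ι κ : Type}

/-- the entries of the adjoint are the transposed entries: `(f†e_i)_k = (fe_k)_i` (real `ℓ²`). [cite: Balaban1984PropagatorsII, (2.8) p.224 («the adjoint operator»), (2.18) p.226, dictionary] -/
theorem adjoint_single_apply [Fintype ι] [DecidableEq ι] [Fintype κ] [DecidableEq κ] (f : EuclideanSpace ℝ κ →ₗ[ℝ] EuclideanSpace ℝ ι) (i : ι) (k : κ) :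
    LinearMap.adjoint f (EuclideanSpace.single i (1 : ℝ)) k = f (EuclideanSpace.single k (1 : ℝ)) i := by
  have h1 : LinearMap.adjoint f (EuclideanSpace.single i (1 : ℝ)) k =
      inner ℝ (EuclideanSpace.single k (1 : ℝ)) (LinearMap.adjoint f (EuclideanSpace.single i (1 : ℝ))) := by
    rw [EuclideanSpace.inner_single_left]; simp
  rw [h1, LinearMap.adjoint_inner_right, EuclideanSpace.inner_single_right]
  simp

/-- **the matrix of (the function-space reading of) an adjoint is the transpose**: `mat(onFun f†) = (mat(onFun f))ᵀ`. [cite: Balaban1984PropagatorsII, (2.8) p.224 («the adjoint operator»), (2.18) p.226, dictionary] -/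
theorem toMatrix'_onFun_adjoint [Fintype ι] [DecidableEq ι] [Fintype κ] [DecidableEq κ] (f : EuclideanSpace ℝ κ →ₗ[ℝ] EuclideanSpace ℝ ι) :
    LinearMap.toMatrix' (onFun (LinearMap.adjoint f)) = (LinearMap.toMatrix' (onFun f))ᵀ := by
  ext k i
  rw [Matrix.transpose_apply, LinearMap.toMatrix'_apply, LinearMap.toMatrix'_apply, onFun_apply, onFun_apply]
  exact adjoint_single_apply f i k

/-- `onFun` is multiplicative. [cite: Balaban1984PropagatorsII, (2.90) p.239 (operators of T_□ read on bond functions), dictionary] -/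
theorem onFun_comp {τ : Type} (f : EuclideanSpace ℝ κ →ₗ[ℝ] EuclideanSpace ℝ ι) (g : EuclideanSpace ℝ τ →ₗ[ℝ] EuclideanSpace ℝ κ) :
    onFun (f ∘ₗ g) = onFun f ∘ₗ onFun g := rfl

/-- `onFun` is additive. [cite: Balaban1984PropagatorsII, (2.90) p.239 (operators of T_□ read on bond functions), dictionary] -/
theorem onFun_add (f g : EuclideanSpace ℝ κ →ₗ[ℝ] EuclideanSpace ℝ ι) : onFun (f + g) = onFun f + onFun g := rfl

/-- `onFun` commutes with scalars. [cite: Balaban1984PropagatorsII, (2.90) p.239 (operators of T_□ read on bond functions), dictionary] -/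
theorem onFun_smul (c : ℝ) (f : EuclideanSpace ℝ κ →ₗ[ℝ] EuclideanSpace ℝ ι) : onFun (c • f) = c • onFun f := rfl

/-- `onFun` of a difference. [cite: Balaban1984PropagatorsII, (2.90) p.239 (operators of T_□ read on bond functions), dictionary] -/
theorem onFun_sub (f g : EuclideanSpace ℝ κ →ₗ[ℝ] EuclideanSpace ℝ ι) : onFun (f - g) = onFun f - onFun g := rfl

/-- `onFun id = id`. [cite: Balaban1984PropagatorsII, (2.90) p.239 (operators of T_□ read on bond functions), dictionary] -/
theorem onFun_id : onFun (LinearMap.id : EuclideanSpace ℝ κ →ₗ[ℝ] EuclideanSpace ℝ κ) = LinearMap.id := rfl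

end Adjoint

/-! ## §2  The generic chart-agreement calculus: windows charted bijectively onto local lattices, kernels that agree on deep
inputs, composition, sums, transposition, and the passage to `T·h = s•(εT′ρ)·h` -/

section ChartCalculus

/-- **A BIJECTIVE WINDOW CHART**: a finite window `W ⊂ X` of the global carrier charted by `e` injectively ONTO the local carrier
`X′` (p. 238: *"We take the cube □̃³ and identify it with a torus, denoted by T_□, imposing periodicity conditions"* — one such
datum for each kind of carrier: sites, bonds, plaquettes). [cite: Balaban1984PropagatorsII, p.238 (T_□ = □̃³), dictionary] -/
structure WChart (X X' : Type) where
  /-- the window -/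
  W : Finset X
  /-- the chart -/
  e : X → X'
  /-- injective on the window -/
  inj : Set.InjOn e ↑W
  /-- onto the local carrier -/
  surj : ∀ x', ∃ x ∈ W, e x = x'

variable {Xi Xi' Xm Xm' Xo Xo' : Type}

/-- a sum over the local carrier is the sum over the window through the chart. [cite: Balaban1984PropagatorsII, p.238–239 (T_□ = □̃³; operators on T_□ «as in (2.19)»), dictionary] -/
theorem WChart.sum_eq {X X' : Type} [Fintype X'] (c : WChart X X') (g : X' → ℝ) :
    ∑ x', g x' = ∑ x ∈ c.W, g (c.e x) := by
  symm
  exact Finset.sum_bij (fun x _ => c.e x) (fun _ _ => Finset.mem_univ _) (fun x hx x₁ hx₁ h => c.inj hx hx₁ h)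
    (fun x' _ => by obtain ⟨x, hx, hx'⟩ := c.surj x'; exact ⟨x, hx, hx'⟩) (fun _ _ => rfl)

/-- **KERNEL AGREEMENT THROUGH THE CHARTS ON A SET OF DEEP INPUTS**: for inputs `x ∈ R` (deep inside the window) the global kernel
`T(y,x)` is `s` times the local kernel `T′(e y, e x)` for window outputs and vanishes for outputs off the window — the typed content of
*"On this torus we define operators R, Δ_a as in (2.17), (2.19)"* (p. 239) for a local stencil read near `□`.
[cite: Balaban1984PropagatorsII, p.239 (operators on T_□ «as in (2.19)»), dictionary] -/
def KAgree [Fintype Xi] [DecidableEq Xi] [Fintype Xi'] [DecidableEq Xi'] [DecidableEq Xo] (cI : WChart Xi Xi') (cO : WChart Xo Xo') (s : ℝ) (T : (Xi → ℝ) →ₗ[ℝ] (Xo → ℝ))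
    (T' : (Xi' → ℝ) →ₗ[ℝ] (Xo' → ℝ)) (R : Set Xi) : Prop :=
  ∀ x ∈ R, ∀ y, LinearMap.toMatrix' T y x = s * (if y ∈ cO.W then LinearMap.toMatrix' T' (cO.e y) (cI.e x) else 0)

/-- **LOCALITY** of a global stencil: inputs in `R₁` only produce outputs in `R₂`. [cite: Balaban1984PropagatorsII, p.238–239 (T_□ = □̃³; operators on T_□ «as in (2.19)»), dictionary] -/
def KLocal [Fintype Xi] [DecidableEq Xi] (T : (Xi → ℝ) →ₗ[ℝ] (Xo → ℝ)) (R₁ : Set Xi) (R₂ : Set Xo) : Prop :=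
  ∀ x ∈ R₁, ∀ y, LinearMap.toMatrix' T y x ≠ 0 → y ∈ R₂

/-- agreement is additive in the operators. [cite: Balaban1984PropagatorsII, p.238–239 (T_□ = □̃³; operators on T_□ «as in (2.19)»), dictionary] -/
theorem KAgree.add [Fintype Xi] [DecidableEq Xi] [Fintype Xi'] [DecidableEq Xi'] [DecidableEq Xo] {cI : WChart Xi Xi'} {cO : WChart Xo Xo'} {s : ℝ} {T₁ T₂ : (Xi → ℝ) →ₗ[ℝ] (Xo → ℝ)}
    {T₁' T₂' : (Xi' → ℝ) →ₗ[ℝ] (Xo' → ℝ)} {R : Set Xi} (h₁ : KAgree cI cO s T₁ T₁' R) (h₂ : KAgree cI cO s T₂ T₂' R) :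
    KAgree cI cO s (T₁ + T₂) (T₁' + T₂') R := by
  intro x hx y
  rw [map_add, map_add, Matrix.add_apply, Matrix.add_apply, h₁ x hx y, h₂ x hx y]
  split_ifs <;> ring

/-- agreement under a common scalar. [cite: Balaban1984PropagatorsII, p.238–239 (T_□ = □̃³; operators on T_□ «as in (2.19)»), dictionary] -/
theorem KAgree.smul [Fintype Xi] [DecidableEq Xi] [Fintype Xi'] [DecidableEq Xi'] [DecidableEq Xo] {cI : WChart Xi Xi'} {cO : WChart Xo Xo'} {s : ℝ} {T : (Xi → ℝ) →ₗ[ℝ] (Xo → ℝ)}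
    {T' : (Xi' → ℝ) →ₗ[ℝ] (Xo' → ℝ)} {R : Set Xi} (h : KAgree cI cO s T T' R) (a : ℝ) :
    KAgree cI cO s (a • T) (a • T') R := by
  intro x hx y
  rw [map_smul, map_smul, Matrix.smul_apply, Matrix.smul_apply, smul_eq_mul, smul_eq_mul, h x hx y]
  split_ifs <;> ring

/-- agreement with rescaled operators: `T = s•T′` through the charts and `T′ = a•T″` give `T = (s·a)•T″`. [cite: Balaban1984PropagatorsII, p.238–239 (T_□ = □̃³; operators on T_□ «as in (2.19)»), dictionary] -/
theorem KAgree.smul_right [Fintype Xi] [DecidableEq Xi] [Fintype Xi'] [DecidableEq Xi'] [DecidableEq Xo] {cI : WChart Xi Xi'} {cO : WChart Xo Xo'} {s : ℝ} {T : (Xi → ℝ) →ₗ[ℝ] (Xo → ℝ)}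
    {T' : (Xi' → ℝ) →ₗ[ℝ] (Xo' → ℝ)} {R : Set Xi} (a : ℝ) (h : KAgree cI cO s T (a • T') R) :
    KAgree cI cO (s * a) T T' R := by
  intro x hx y
  rw [h x hx y, map_smul, Matrix.smul_apply, smul_eq_mul]
  split_ifs <;> ring

/-- **COMPOSITION**: if `T₁` agrees with `T₁′` on `R₁` (factor `s₁ ≠ 0`) and sends `R₁` into `R₂ ⊂` the middle window, and `T₂` agrees
with `T₂′` on `R₂` (factor `s₂`), then `T₂T₁` agrees with `T₂′T₁′` on `R₁` with factor `s₂s₁` (`R₂` need not lie in the window: off-window outputs of `T₁` vanish). [cite: Balaban1984PropagatorsII, p.238–239 (T_□ = □̃³; operators on T_□ «as in (2.19)»), dictionary] -/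
theorem KAgree.comp [Fintype Xi] [DecidableEq Xi] [Fintype Xi'] [DecidableEq Xi'] [Fintype Xm] [DecidableEq Xm]
    [Fintype Xm'] [DecidableEq Xm'] [DecidableEq Xo] {cI : WChart Xi Xi'} {cM : WChart Xm Xm'} {cO : WChart Xo Xo'} {s₁ s₂ : ℝ}
    {T₁ : (Xi → ℝ) →ₗ[ℝ] (Xm → ℝ)} {T₁' : (Xi' → ℝ) →ₗ[ℝ] (Xm' → ℝ)} {T₂ : (Xm → ℝ) →ₗ[ℝ] (Xo → ℝ)}
    {T₂' : (Xm' → ℝ) →ₗ[ℝ] (Xo' → ℝ)} {R₁ : Set Xi} {R₂ : Set Xm}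
    (h₁ : KAgree cI cM s₁ T₁ T₁' R₁) (hs₁ : s₁ ≠ 0) (hloc : KLocal T₁ R₁ R₂)
    (h₂ : KAgree cM cO s₂ T₂ T₂' R₂) : KAgree cI cO (s₂ * s₁) (T₂ ∘ₗ T₁) (T₂' ∘ₗ T₁') R₁ := by
  classical
  intro x hx y
  -- the local kernel of `T₁′` vanishes on charted middle points off `R₂`
  have hvan : ∀ z ∈ cM.W, z ∉ R₂ → LinearMap.toMatrix' T₁' (cM.e z) (cI.e x) = 0 := by
    intro z hz hzR
    have h0 : LinearMap.toMatrix' T₁ z x = 0 := by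
      by_contra hne
      exact hzR (hloc x hx z hne)
    have := h₁ x hx z
    rw [h0, if_pos hz] at this
    exact (mul_eq_zero.mp this.symm).resolve_left hs₁
  rw [toMatrix'_comp_apply]
  -- global side: only `z ∈ R₂` contribute
  have hglob : ∑ z, LinearMap.toMatrix' T₂ y z * LinearMap.toMatrix' T₁ z x =
      ∑ z ∈ cM.W, LinearMap.toMatrix' T₂ y z * (s₁ * LinearMap.toMatrix' T₁' (cM.e z) (cI.e x)) := by
    rw [← Finset.sum_subset (Finset.subset_univ cM.W)]
    · refine Finset.sum_congr rfl fun z hz => ?_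
      rw [h₁ x hx z, if_pos hz]
    · intro z _ hz
      rw [h₁ x hx z, if_neg hz, mul_zero, mul_zero]
  rw [hglob]
  by_cases hy : y ∈ cO.W
  · rw [if_pos hy, toMatrix'_comp_apply, cM.sum_eq, Finset.mul_sum]
    refine Finset.sum_congr rfl fun z hz => ?_
    by_cases hzR : z ∈ R₂
    · rw [h₂ z hzR y, if_pos hy]; ring
    · rw [hvan z hz hzR]; ring
  · rw [if_neg hy, mul_zero]
    refine Finset.sum_eq_zero fun z hz => ?_
    by_cases hzR : z ∈ R₂
    · rw [h₂ z hzR y, if_neg hy]; ring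
    · rw [hvan z hz hzR]; ring

/-- **TRANSPOSITION** (for adjoint pairs): if `T` agrees with `T′` on the deep inputs `R_I`, the deep outputs `R_O` only see inputs in
`R_I` (globally, and locally through the charts), then the transposes agree on `R_O` with the same factor. [cite: Balaban1984PropagatorsII, p.238–239 (T_□ = □̃³; operators on T_□ «as in (2.19)»), dictionary] -/
theorem KAgree.transpose [Fintype Xi] [DecidableEq Xi] [Fintype Xi'] [DecidableEq Xi'] [Fintype Xo] [DecidableEq Xo]
    [Fintype Xo'] [DecidableEq Xo'] {cI : WChart Xi Xi'} {cO : WChart Xo Xo'} {s : ℝ} {T : (Xi → ℝ) →ₗ[ℝ] (Xo → ℝ)}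
    {T' : (Xi' → ℝ) →ₗ[ℝ] (Xo' → ℝ)} {R_I : Set Xi} {R_O : Set Xo} (h : KAgree cI cO s T T' R_I) (hRI : R_I ⊆ ↑cI.W)
    (hRO : R_O ⊆ ↑cO.W) (hrev : ∀ y ∈ R_O, ∀ x, LinearMap.toMatrix' T y x ≠ 0 → x ∈ R_I)
    (hrev' : ∀ y ∈ R_O, ∀ x ∈ cI.W, x ∉ R_I → LinearMap.toMatrix' T' (cO.e y) (cI.e x) = 0)
    {Tt : (Xo → ℝ) →ₗ[ℝ] (Xi → ℝ)} {Tt' : (Xo' → ℝ) →ₗ[ℝ] (Xi' → ℝ)}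
    (hTt : LinearMap.toMatrix' Tt = (LinearMap.toMatrix' T)ᵀ) (hTt' : LinearMap.toMatrix' Tt' = (LinearMap.toMatrix' T')ᵀ) :
    KAgree cO cI s Tt Tt' R_O := by
  intro y hy x
  rw [hTt, hTt', Matrix.transpose_apply, Matrix.transpose_apply]
  by_cases hxR : x ∈ R_I
  · rw [h x hxR y, if_pos (Finset.mem_coe.1 (hRO hy)), if_pos (Finset.mem_coe.1 (hRI hxR))]
  · have h0 : LinearMap.toMatrix' T y x = 0 := by
      by_contra hne
      exact hxR (hrev y hy x hne)
    rw [h0]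
    by_cases hxW : x ∈ cI.W
    · rw [if_pos hxW, hrev' y hy x hxW hxR, mul_zero]
    · rw [if_neg hxW, mul_zero]

/-- agreement on a smaller deep set. [cite: Balaban1984PropagatorsII, p.238–239 (T_□ = □̃³; operators on T_□ «as in (2.19)»), dictionary] -/
theorem KAgree.mono [Fintype Xi] [DecidableEq Xi] [Fintype Xi'] [DecidableEq Xi'] [DecidableEq Xo] {cI : WChart Xi Xi'} {cO : WChart Xo Xo'} {s : ℝ} {T : (Xi → ℝ) →ₗ[ℝ] (Xo → ℝ)}
    {T' : (Xi' → ℝ) →ₗ[ℝ] (Xo' → ℝ)} {R R' : Set Xi} (h : KAgree cI cO s T T' R) (hR : R' ⊆ R) : KAgree cI cO s T T' R' :=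
  fun x hx y => h x (hR hx) y

/-- locality to a larger target. [cite: Balaban1984PropagatorsII, p.238–239 (T_□ = □̃³; operators on T_□ «as in (2.19)»), dictionary] -/
theorem KLocal.mono [Fintype Xi] [DecidableEq Xi] {T : (Xi → ℝ) →ₗ[ℝ] (Xo → ℝ)} {R₁ R₁' : Set Xi} {R₂ R₂' : Set Xo} (h : KLocal T R₁ R₂) (h₁ : R₁' ⊆ R₁)
    (h₂ : R₂ ⊆ R₂') : KLocal T R₁' R₂' :=
  fun x hx y hy => h₂ (h x (h₁ hx) y hy)

/-- locality of a sum. [cite: Balaban1984PropagatorsII, p.238–239 (T_□ = □̃³; operators on T_□ «as in (2.19)»), dictionary] -/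
theorem KLocal.add [Fintype Xi] [DecidableEq Xi] {T₁ T₂ : (Xi → ℝ) →ₗ[ℝ] (Xo → ℝ)} {R₁ : Set Xi} {R₂ : Set Xo} (h₁ : KLocal T₁ R₁ R₂) (h₂ : KLocal T₂ R₁ R₂) :
    KLocal (T₁ + T₂) R₁ R₂ := by
  intro x hx y hy
  rw [map_add, Matrix.add_apply] at hy
  by_cases h : LinearMap.toMatrix' T₁ y x = 0
  · rw [h, zero_add] at hy
    exact h₂ x hx y hy
  · exact h₁ x hx y h

/-- locality of a composite. [cite: Balaban1984PropagatorsII, p.238–239 (T_□ = □̃³; operators on T_□ «as in (2.19)»), dictionary] -/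
theorem KLocal.comp [Fintype Xi] [DecidableEq Xi] [Fintype Xm] [DecidableEq Xm] {T₁ : (Xi → ℝ) →ₗ[ℝ] (Xm → ℝ)} {T₂ : (Xm → ℝ) →ₗ[ℝ] (Xo → ℝ)} {R₁ : Set Xi} {R₂ : Set Xm} {R₃ : Set Xo}
    (h₁ : KLocal T₁ R₁ R₂) (h₂ : KLocal T₂ R₂ R₃) : KLocal (T₂ ∘ₗ T₁) R₁ R₃ := by
  classical
  intro x hx y hy
  rw [toMatrix'_comp_apply] at hy
  obtain ⟨z, _, hz⟩ := Finset.exists_ne_zero_of_sum_ne_zero hy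
  have hz₁ : LinearMap.toMatrix' T₁ z x ≠ 0 := fun h0 => hz (by rw [h0, mul_zero])
  have hz₂ : LinearMap.toMatrix' T₂ y z ≠ 0 := fun h0 => hz (by rw [h0, zero_mul])
  exact h₂ z (h₁ x hx z hz₁) y hz₂

/-- **FROM KERNEL AGREEMENT TO THE OPERATOR IDENTITY OF (2.91)**: if the global `T` agrees (factor `s`) with the local `T′` through ONE
bijective window chart on the deep inputs `R`, then for every cut-off `h` supported in `R`, `T·h = s•(εT′ρ)·h` — the shape of the
hypothesis `hagree` of `B6GlobalChartV1.prop26_2136_V1_of_2134_eq291` (`M·h_□ = M_□·h_□`). [cite: Balaban1984PropagatorsII, (2.90)–(2.91) p.239, p.238 (T_□)] -/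
theorem KAgree.mul_mulOp [Fintype Xi] [DecidableEq Xi] [Fintype Xi'] [DecidableEq Xi'] {c : WChart Xi Xi'} {s : ℝ} {T : Module.End ℝ (Xi → ℝ)} {T' : Module.End ℝ (Xi' → ℝ)} {R : Set Xi}
    (hT : KAgree c c s T T' R) (hR : R ⊆ ↑c.W) (h : Xi → ℝ) (hh : ∀ x, h x ≠ 0 → x ∈ R) :
    T * mulOp h = s • (transplant c.W c.e T' * mulOp h) := by
  classical
  apply LinearMap.ext
  intro f
  funext y
  rw [Module.End.mul_apply, LinearMap.smul_apply, Module.End.mul_apply, Pi.smul_apply, smul_eq_mul, transplant_apply,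
    apply_eq_sum_toMatrix]
  have hzero : ∀ x, x ∉ R → h x = 0 := fun x hx => by
    by_contra hne
    exact hx (hh x hne)
  by_cases hy : y ∈ c.W
  · rw [if_pos hy, apply_eq_sum_toMatrix, c.sum_eq, Finset.mul_sum,
      ← Finset.sum_subset (Finset.subset_univ c.W)]
    · refine Finset.sum_congr rfl fun x hx => ?_
      rw [restrictOp_apply_of_injOn c.inj _ hx, mulOp_apply]
      by_cases hxR : x ∈ R
      · rw [hT x hxR y, if_pos hy]; ring
      · rw [hzero x hxR]; ring
    · intro x _ hx
      rw [mulOp_apply, hzero x (fun hxR => hx (hR hxR))]; ring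
  · rw [if_neg hy, mul_zero]
    refine Finset.sum_eq_zero fun x _ => ?_
    by_cases hxR : x ∈ R
    · rw [hT x hxR y, if_neg hy]; ring
    · rw [mulOp_apply, hzero x hxR]; ring

end ChartCalculus

/-- restrictions through charts that agree on the window coincide. [cite: Balaban1984PropagatorsII, p.238–239 (T_□ = □̃³; operators on T_□ «as in (2.19)»), dictionary] -/
theorem restrictOp_congr {X X' : Type} [DecidableEq X'] (W : Finset X) {e e' : X → X'} (h : ∀ x ∈ W, e x = e' x)
    (f : X → ℝ) : restrictOp W e f = restrictOp W e' f := by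
  funext x'
  rw [restrictOp_apply, restrictOp_apply]
  refine Finset.sum_congr ?_ fun _ _ => rfl
  ext y
  simp only [Finset.mem_filter, and_congr_right_iff]
  intro hy
  rw [h y hy]

/-- transplants through charts that agree on the window coincide (only window points are ever charted). [cite: Balaban1984PropagatorsII, p.238–239 (T_□ = □̃³; operators on T_□ «as in (2.19)»), dictionary] -/
theorem transplant_congr {X X' : Type} [DecidableEq X'] [DecidableEq X] (W : Finset X) {e e' : X → X'}
    (h : ∀ x ∈ W, e x = e' x) (T' : Module.End ℝ (X' → ℝ)) : transplant W e T' = transplant W e' T' := by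
  apply LinearMap.ext
  intro f
  funext x
  rw [transplant_apply, transplant_apply, restrictOp_congr W h f]
  by_cases hx : x ∈ W
  · rw [if_pos hx, if_pos hx, h x hx]
  · rw [if_neg hx, if_neg hx]

/-! ## §3  The V1 window charts: sites, bonds and plaquettes of the global torus `T_η` over a full window `[x₀, x₀ + 2L^{m_□+K_□})^{d+1}`
of the fundamental box, charted onto the member torus `T_□`; deep regions; the charts intertwine the lattice translations -/

section V1Charts

open B6Prop25TwoScaleCensus (TSIdx)
open B6Prop26ReachTransplant (siteOfInt chartBond InWindow)
open B6GlobalChartV1 (PV)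

variable {d ℓ : ℕ} {hd : 1 ≤ d + 1} {hL : Odd (ℓ + 1) ∧ 1 < ℓ + 1} {a₀ a₁ : ℝ} {m K : ℕ}

/-- decidable equality of plaquettes (a plaquette is its corner and its two directions). [folklore] -/
instance instDecidableEqPlaq (P : Params) (j : ℕ) : DecidableEq (Plaq P j) := fun p q =>
  decidable_of_iff (p.src = q.src ∧ p.μ = q.μ ∧ p.ν = q.ν)
    ⟨fun h => by
      cases p
      cases q
      obtain ⟨h1, h2, h3⟩ := h
      simp only at h1 h2 h3
      subst h1; subst h2; subst h3
      rfl,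
     fun h => h ▸ ⟨rfl, rfl, rfl⟩⟩

variable (t : TSIdx d (ℓ + 1) hd hL a₀ a₁) (x₀ : Fin (d + 1) → ℤ)

/-- the label coordinates of the initial point of a bond of the global torus (`toBox` of `B6GlobalChartV1` read as integers). [cite: Balaban1984PropagatorsII, (2.1) p.224, dictionary] -/
def posV (b : PBond (PV d ℓ m K hd hL) 0) : Fin (d + 1) → ℤ := fun μ => ((b.src μ).val : ℤ)

/-- **THE SITE CHART** of the window with corner `x₀` onto the fine torus of the member: labels minus the corner, read modulo the
member's period (p. 238: *"identify it with a torus, denoted by T_□, imposing periodicity conditions"*). [cite: Balaban1984PropagatorsII, p.238 (T_□), dictionary] -/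
def eS (x : Site (PV d ℓ m K hd hL) 0) : Site t.P 0 := fun μ => ((((x μ).val : ℤ) - x₀ μ : ℤ) : ZMod (t.P.sitesPerDir 0))

/-- the bond chart: initial point charted, direction kept. [cite: Balaban1984PropagatorsII, p.238 (T_□), p.224 («Ω also the set of bonds»), dictionary] -/
def eB (b : PBond (PV d ℓ m K hd hL) 0) : PBond t.P 0 := ⟨eS t x₀ b.src, b.dir⟩

/-- the plaquette chart: corner charted, directions kept. [cite: Balaban1984PropagatorsII, p.238 (T_□), dictionary] -/
def eP (p : Plaq (PV d ℓ m K hd hL) 0) : Plaq t.P 0 := ⟨eS t x₀ p.src, p.μ, p.ν, p.hμν⟩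

/-- **THE DEEP REGIONS** of the window: sites whose labels keep the margin `r` from every face of the window
`[x₀_μ, x₀_μ + 2L^{m_□+K_□})` (so that stencils of range `≤ r` around them stay inside). [cite: Balaban1984PropagatorsII, p.238 (□ ⊂ □̃ ⊂ □̃² ⊂ □̃³), dictionary] -/
def DeepS (r : ℕ) : Set (Site (PV d ℓ m K hd hL) 0) :=
  {x | ∀ μ, x₀ μ + r ≤ ((x μ).val : ℤ) ∧ ((x μ).val : ℤ) + r < x₀ μ + (t.P.sitesPerDir 0 : ℕ)}

/-- deep bonds: deep initial point. [cite: Balaban1984PropagatorsII, p.238, dictionary] -/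
def DeepB (r : ℕ) : Set (PBond (PV d ℓ m K hd hL) 0) := {b | b.src ∈ DeepS t x₀ r}

/-- deep plaquettes: deep corner. [cite: Balaban1984PropagatorsII, p.238, dictionary] -/
def DeepP (r : ℕ) : Set (Plaq (PV d ℓ m K hd hL) 0) := {p | p.src ∈ DeepS t x₀ r}

variable {t x₀}

/-- a deeper site is deep. [cite: Balaban1984PropagatorsII, p.238–239 (T_□ = □̃³; operators on T_□ «as in (2.19)»), dictionary] -/
theorem deepS_mono {r r' : ℕ} (h : r ≤ r') : DeepS t x₀ r' ⊆ DeepS (m := m) (K := K) t x₀ r := by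
  intro x hx μ
  obtain ⟨h1, h2⟩ := hx μ
  constructor <;> omega

/-- one coordinate of `x + e_μ` on the torus: `val (x + e_μ)_μ = val x_μ + 1` away from the seam. [folklore] -/
private theorem val_shift_self {P : Params} {j : ℕ} (x : Site P j) (μ : Fin P.d) (h : (x μ).val + 1 < P.sitesPerDir j) :
    ((x.shift μ) μ).val = (x μ).val + 1 := by
  have h1 : (x.shift μ) μ = x μ + 1 := by simp [Site.shift]
  rw [h1, ZMod.val_add_of_lt (by rw [ZMod.val_one]; exact h), ZMod.val_one]

/-- one coordinate of `x − e_μ`: `val (x − e_μ)_μ = val x_μ − 1` away from the seam. [folklore] -/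
private theorem val_unshift_self {P : Params} {j : ℕ} (x : Site P j) (μ : Fin P.d) (h : 1 ≤ (x μ).val) :
    ((x.unshift μ) μ).val = (x μ).val - 1 := by
  have h1 : (x.unshift μ) μ = x μ - 1 := by simp [Site.unshift]
  rw [h1, ZMod.val_sub (by rw [ZMod.val_one]; exact h), ZMod.val_one]

/-- the other coordinates of `x ± e_μ` are those of `x`. [folklore] -/
private theorem shift_apply_ne {P : Params} {j : ℕ} (x : Site P j) {μ ν : Fin P.d} (h : ν ≠ μ) : (x.shift μ) ν = x ν := by
  simp [Site.shift, Function.update_of_ne h]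

/-- the other coordinates of `x − e_μ`. [folklore] -/
private theorem unshift_apply_ne {P : Params} {j : ℕ} (x : Site P j) {μ ν : Fin P.d} (h : ν ≠ μ) : (x.unshift μ) ν = x ν := by
  simp [Site.unshift, Function.update_of_ne h]

/-- `x + e_μ` of a site of margin `r + 1` has margin `r` (and its labels move by `e_μ`: no wrap of the global torus inside the window). [cite: Balaban1984PropagatorsII, p.238–239 (T_□ = □̃³; operators on T_□ «as in (2.19)»), dictionary] -/
theorem shift_mem_deepS (hfit : ∀ μ, x₀ μ + (t.P.sitesPerDir 0 : ℕ) ≤ ((PV d ℓ m K hd hL).sitesPerDir 0 : ℕ)) {r : ℕ} {x : Site (PV d ℓ m K hd hL) 0} (hx : x ∈ DeepS t x₀ (r + 1)) (μ : Fin (d + 1)) :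
    x.shift μ ∈ DeepS t x₀ r ∧ ((x.shift μ) μ).val = (x μ).val + 1 := by
  obtain ⟨hμ1, hμ2⟩ := hx μ
  have hlt : (x μ).val + 1 < (PV d ℓ m K hd hL).sitesPerDir 0 := by have := hfit μ; omega
  have hv := val_shift_self x μ hlt
  refine ⟨fun ν => ?_, hv⟩
  by_cases hν : ν = μ
  · subst hν; rw [hv]; constructor <;> omega
  · rw [shift_apply_ne x hν]; obtain ⟨h1, h2⟩ := hx ν; constructor <;> omega

/-- `x − e_μ` of a site of margin `r + 1` has margin `r`. [cite: Balaban1984PropagatorsII, p.238–239 (T_□ = □̃³; operators on T_□ «as in (2.19)»), dictionary] -/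
theorem unshift_mem_deepS (hx₀ : ∀ μ, 0 ≤ x₀ μ) {r : ℕ} {x : Site (PV d ℓ m K hd hL) 0} (hx : x ∈ DeepS t x₀ (r + 1)) (μ : Fin (d + 1)) :
    x.unshift μ ∈ DeepS t x₀ r ∧ ((x.unshift μ) μ).val + 1 = (x μ).val := by
  obtain ⟨hμ1, hμ2⟩ := hx μ
  have h1 : 1 ≤ (x μ).val := by have := hx₀ μ; omega
  have hv := val_unshift_self x μ h1
  refine ⟨fun ν => ?_, by omega⟩
  by_cases hν : ν = μ
  · subst hν; rw [hv]; constructor <;> omega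
  · rw [unshift_apply_ne x hν]; obtain ⟨h1, h2⟩ := hx ν; constructor <;> omega

/-- **THE SITE CHART INTERTWINES `x ↦ x + e_μ`** wherever the global label does not wrap. [cite: Balaban1984PropagatorsII, p.238 (T_□ with periodicity conditions), dictionary] -/
theorem eS_shift_of_val {x : Site (PV d ℓ m K hd hL) 0} {μ : Fin (d + 1)} (hv : ((x.shift μ) μ).val = (x μ).val + 1) :
    eS t x₀ (x.shift μ) = (eS t x₀ x).shift μ := by
  funext ν
  by_cases hν : ν = μ
  · subst hν
    have hR : ((eS t x₀ x).shift ν) ν = eS t x₀ x ν + 1 := by simp [Site.shift]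
    rw [hR]
    show ((((((x.shift ν) ν).val : ℤ) - x₀ ν : ℤ)) : ZMod (t.P.sitesPerDir 0)) =
      ((((x ν).val : ℤ) - x₀ ν : ℤ) : ZMod (t.P.sitesPerDir 0)) + 1
    rw [hv]; push_cast; ring
  · have hR : ((eS t x₀ x).shift μ) ν = eS t x₀ x ν := by simp [Site.shift, Function.update_of_ne hν]
    rw [hR]
    show ((((((x.shift μ) ν).val : ℤ) - x₀ ν : ℤ)) : ZMod (t.P.sitesPerDir 0)) =
      ((((x ν).val : ℤ) - x₀ ν : ℤ) : ZMod (t.P.sitesPerDir 0))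
    rw [shift_apply_ne x hν]

/-- the site chart intertwines `x ↦ x − e_μ` wherever the global label does not wrap. [cite: Balaban1984PropagatorsII, p.238, dictionary] -/
theorem eS_unshift_of_val {x : Site (PV d ℓ m K hd hL) 0} {μ : Fin (d + 1)} (hv : ((x.unshift μ) μ).val + 1 = (x μ).val) :
    eS t x₀ (x.unshift μ) = (eS t x₀ x).unshift μ := by
  funext ν
  by_cases hν : ν = μ
  · subst hν
    have hR : ((eS t x₀ x).unshift ν) ν = eS t x₀ x ν - 1 := by simp [Site.unshift]
    rw [hR]
    show ((((((x.unshift ν) ν).val : ℤ) - x₀ ν : ℤ)) : ZMod (t.P.sitesPerDir 0)) =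
      ((((x ν).val : ℤ) - x₀ ν : ℤ) : ZMod (t.P.sitesPerDir 0)) - 1
    have : ((x ν).val : ℤ) = ((x.unshift ν) ν).val + 1 := by exact_mod_cast hv.symm
    rw [this]; push_cast; ring
  · have hR : ((eS t x₀ x).unshift μ) ν = eS t x₀ x ν := by simp [Site.unshift, Function.update_of_ne hν]
    rw [hR]
    show ((((((x.unshift μ) ν).val : ℤ) - x₀ ν : ℤ)) : ZMod (t.P.sitesPerDir 0)) =
      ((((x ν).val : ℤ) - x₀ ν : ℤ) : ZMod (t.P.sitesPerDir 0))
    rw [unshift_apply_ne x hν]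

/-- on a site of margin `1`: `e(x + e_μ) = e(x) + e_μ`. [cite: Balaban1984PropagatorsII, p.238, dictionary] -/
theorem eS_shift (hfit : ∀ μ, x₀ μ + (t.P.sitesPerDir 0 : ℕ) ≤ ((PV d ℓ m K hd hL).sitesPerDir 0 : ℕ))
    {x : Site (PV d ℓ m K hd hL) 0} (hx : x ∈ DeepS t x₀ 1) (μ : Fin (d + 1)) :
    eS t x₀ (x.shift μ) = (eS t x₀ x).shift μ :=
  eS_shift_of_val (shift_mem_deepS hfit (r := 0) hx μ).2

/-- on a site of margin `1`: `e(x − e_μ) = e(x) − e_μ`. [cite: Balaban1984PropagatorsII, p.238, dictionary] -/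
theorem eS_unshift (hx₀ : ∀ μ, 0 ≤ x₀ μ) {x : Site (PV d ℓ m K hd hL) 0} (hx : x ∈ DeepS t x₀ 1) (μ : Fin (d + 1)) :
    eS t x₀ (x.unshift μ) = (eS t x₀ x).unshift μ :=
  eS_unshift_of_val (unshift_mem_deepS hx₀ (r := 0) hx μ).2

/-- labels of charted window sites: `val (e x)_μ = val x_μ − x₀_μ`. [cite: Balaban1984PropagatorsII, p.238, dictionary] -/
theorem val_eS {x : Site (PV d ℓ m K hd hL) 0} (hx : x ∈ DeepS t x₀ 0) (μ : Fin (d + 1)) :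
    (((eS t x₀ x) μ).val : ℤ) = ((x μ).val : ℤ) - x₀ μ := by
  obtain ⟨hμ1, hμ2⟩ := hx μ
  simp only [eS, ZMod.val_intCast]
  exact Int.emod_eq_of_lt (by omega) (by omega)

/-- the site chart is injective on the window. [cite: Balaban1984PropagatorsII, p.238 (T_□ = □̃³), dictionary] -/
theorem eS_injOn : Set.InjOn (eS t x₀) (DeepS (m := m) (K := K) t x₀ 0) := by
  intro x hx x' hx' h
  funext μ
  apply ZMod.val_injective
  have h1 := val_eS hx μ
  have h2 := val_eS hx' μ
  rw [h] at h1
  have : ((x μ).val : ℤ) = (x' μ).val := by linarith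
  exact_mod_cast this

/-- **THE FULL WINDOW IS ONTO `T_□`** (sites). [cite: Balaban1984PropagatorsII, p.238 (T_□ = □̃³ with periodicity conditions), dictionary] -/
theorem eS_surj (hx₀ : ∀ μ, 0 ≤ x₀ μ) (hfit : ∀ μ, x₀ μ + (t.P.sitesPerDir 0 : ℕ) ≤ ((PV d ℓ m K hd hL).sitesPerDir 0 : ℕ))
    (s : Site t.P 0) : ∃ x ∈ DeepS (m := m) (K := K) t x₀ 0, eS t x₀ x = s := by
  refine ⟨fun μ => ((x₀ μ + ((s μ).val : ℕ) : ℤ) : ZMod ((PV d ℓ m K hd hL).sitesPerDir 0)), fun μ => ?_, ?_⟩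
  · have hs := ZMod.val_lt (s μ)
    have hf := hfit μ
    have h0 := hx₀ μ
    simp only [ZMod.val_intCast]
    rw [Int.emod_eq_of_lt (by positivity) (by omega)]
    constructor <;> push_cast <;> omega
  · funext μ
    have hs := ZMod.val_lt (s μ)
    have hf := hfit μ
    have h0 := hx₀ μ
    simp only [eS, ZMod.val_intCast]
    rw [Int.emod_eq_of_lt (by positivity) (by omega)]
    simp

/-- on the window the site chart IS `siteOfInt` of the relative labels (the chart of `B6Prop26ReachTransplant`). [cite: Balaban1984PropagatorsII, p.238, dictionary] -/
theorem eS_eq_siteOfInt {x : Site (PV d ℓ m K hd hL) 0} (hx : x ∈ DeepS t x₀ 0) :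
    eS t x₀ x = siteOfInt t (fun μ => ((x μ).val : ℤ) - x₀ μ) := by
  funext μ
  have hμ := (hx μ).1
  obtain ⟨n, hn⟩ := Int.eq_ofNat_of_zero_le (show (0 : ℤ) ≤ ((x μ).val : ℤ) - x₀ μ by omega)
  simp only [eS, siteOfInt, hn, Int.toNat_natCast, Int.cast_natCast]

/-- on window bonds the bond chart IS `chartBond` of `B6Prop26ReachTransplant` (so every transplant below is the `GlV1`-transplant). [cite: Balaban1984PropagatorsII, p.238, dictionary] -/
theorem eB_eq_chartBond {b : PBond (PV d ℓ m K hd hL) 0} (hb : b ∈ DeepB t x₀ 0) :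
    eB t x₀ b = chartBond t posV PBond.dir x₀ b := by
  show (⟨eS t x₀ b.src, b.dir⟩ : PBond t.P 0) = ⟨siteOfInt t (fun μ => posV b μ - x₀ μ), b.dir⟩
  rw [eS_eq_siteOfInt hb]
  rfl

end V1Charts

/-! ## §4  The three window charts as `WChart`s and the kernels of the V1 stencils `∂` (sites → bonds), `∂` (bonds → plaquettes);
`∂*` and the plaquette `∂*` as their adjoints -/

section Stencils

open B6Prop25TwoScaleCensus (TSIdx)
open B6GlobalChartV1 (PV)
open B6SectAOperatorsV1 (dE dsE dcE dcsE gradFn curlFn dsE_eq_adjoint)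
open B6Ineq2133TwoScaleV1 (onFun onFun_apply onFun_onE)
open LatticeFieldCalculus (grad curl)

variable {d ℓ : ℕ} {hd : 1 ≤ d + 1} {hL : Odd (ℓ + 1) ∧ 1 < ℓ + 1} {a₀ a₁ : ℝ} {m K : ℕ}
variable (t : TSIdx d (ℓ + 1) hd hL a₀ a₁) (x₀ : Fin (d + 1) → ℤ)
variable (hx₀ : ∀ μ, 0 ≤ x₀ μ) (hfit : ∀ μ, x₀ μ + (t.P.sitesPerDir 0 : ℕ) ≤ ((PV d ℓ m K hd hL).sitesPerDir 0 : ℕ))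

/-- `(x + e_μ) − e_μ = x` on any torus. [folklore] -/
private theorem unshift_shift' {P : Params} {j : ℕ} (x : Site P j) (μ : Fin P.d) : (x.shift μ).unshift μ = x := by
  funext ν
  by_cases h : ν = μ
  · subst h; simp [Site.shift, Site.unshift]
  · simp [Site.shift, Site.unshift, Function.update_of_ne h]

/-- `(x − e_μ) + e_μ = x` on any torus. [folklore] -/
private theorem shift_unshift' {P : Params} {j : ℕ} (x : Site P j) (μ : Fin P.d) : (x.unshift μ).shift μ = x := by
  funext ν
  by_cases h : ν = μ
  · subst h; simp [Site.shift, Site.unshift]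
  · simp [Site.shift, Site.unshift, Function.update_of_ne h]

/-- `y + e_μ = x ↔ y = x − e_μ`. [folklore] -/
private theorem shift_eq_iff {P : Params} {j : ℕ} (y x : Site P j) (μ : Fin P.d) : y.shift μ = x ↔ y = x.unshift μ := by
  constructor
  · rintro rfl; exact (unshift_shift' y μ).symm
  · rintro rfl; exact shift_unshift' x μ

open Classical in
/-- **THE SITE WINDOW CHART** (full window, bijective onto the member's fine torus). [cite: Balaban1984PropagatorsII, p.238 (T_□ = □̃³), dictionary] -/
def cS : WChart (Site (PV d ℓ m K hd hL) 0) (Site t.P 0) where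
  W := Finset.univ.filter (fun x => x ∈ DeepS t x₀ 0)
  e := eS t x₀
  inj := fun x hx x' hx' h => eS_injOn (Finset.mem_filter.1 (Finset.mem_coe.1 hx)).2 (Finset.mem_filter.1 (Finset.mem_coe.1 hx')).2 h
  surj := fun s => by
    obtain ⟨x, hx, h⟩ := eS_surj hx₀ hfit s
    exact ⟨x, Finset.mem_filter.2 ⟨Finset.mem_univ _, hx⟩, h⟩

open Classical in
/-- **THE BOND WINDOW CHART** (full window, bijective onto the member's fine bonds). [cite: Balaban1984PropagatorsII, p.238, p.224 («Ω also the set of bonds»), dictionary] -/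
def cB : WChart (PBond (PV d ℓ m K hd hL) 0) (PBond t.P 0) where
  W := Finset.univ.filter (fun b => b ∈ DeepB t x₀ 0)
  e := eB t x₀
  inj := fun b hb b' hb' h => by
    have h1 : eS t x₀ b.src = eS t x₀ b'.src := congrArg PBond.src h
    have h2 : b.dir = b'.dir := by have := congrArg PBond.dir h; exact this
    have hs := eS_injOn (Finset.mem_filter.1 (Finset.mem_coe.1 hb)).2 (Finset.mem_filter.1 (Finset.mem_coe.1 hb')).2 h1
    cases b; cases b'; simp only at hs h2; subst hs; subst h2; rfl
  surj := fun b' => by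
    obtain ⟨x, hx, h⟩ := eS_surj hx₀ hfit b'.src
    refine ⟨⟨x, b'.dir⟩, Finset.mem_filter.2 ⟨Finset.mem_univ _, hx⟩, ?_⟩
    cases b'; simp only [eB] at h ⊢; rw [h]

open Classical in
/-- **THE PLAQUETTE WINDOW CHART** (full window, bijective onto the member's fine plaquettes). [cite: Balaban1984PropagatorsII, p.238, dictionary] -/
def cP : WChart (Plaq (PV d ℓ m K hd hL) 0) (Plaq t.P 0) where
  W := Finset.univ.filter (fun p => p ∈ DeepP t x₀ 0)
  e := eP t x₀
  inj := fun p hp p' hp' h => by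
    have h1 : eS t x₀ p.src = eS t x₀ p'.src := congrArg Plaq.src h
    have h2 : p.μ = p'.μ := by have := congrArg Plaq.μ h; exact this
    have h3 : p.ν = p'.ν := by have := congrArg Plaq.ν h; exact this
    have hs := eS_injOn (Finset.mem_filter.1 (Finset.mem_coe.1 hp)).2 (Finset.mem_filter.1 (Finset.mem_coe.1 hp')).2 h1
    cases p; cases p'; simp only at hs h2 h3; subst hs; subst h2; subst h3; rfl
  surj := fun p' => by
    obtain ⟨x, hx, h⟩ := eS_surj hx₀ hfit p'.src
    refine ⟨⟨x, p'.μ, p'.ν, p'.hμν⟩, Finset.mem_filter.2 ⟨Finset.mem_univ _, hx⟩, ?_⟩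
    cases p'; simp only [eP] at h ⊢; simp only [h]

variable {t x₀ hx₀ hfit}

/-- membership in the site window. [cite: Balaban1984PropagatorsII, p.238–239 (T_□ = □̃³; operators on T_□ «as in (2.19)»), dictionary] -/
@[simp] theorem mem_cS_W {x : Site (PV d ℓ m K hd hL) 0} : x ∈ (cS t x₀ hx₀ hfit).W ↔ x ∈ DeepS t x₀ 0 := by
  classical
  simp [cS]

/-- membership in the bond window. [cite: Balaban1984PropagatorsII, p.238–239 (T_□ = □̃³; operators on T_□ «as in (2.19)»), dictionary] -/
@[simp] theorem mem_cB_W {b : PBond (PV d ℓ m K hd hL) 0} : b ∈ (cB t x₀ hx₀ hfit).W ↔ b.src ∈ DeepS t x₀ 0 := by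
  classical
  simp [cB, DeepB]

/-- membership in the plaquette window. [cite: Balaban1984PropagatorsII, p.238–239 (T_□ = □̃³; operators on T_□ «as in (2.19)»), dictionary] -/
@[simp] theorem mem_cP_W {p : Plaq (PV d ℓ m K hd hL) 0} : p ∈ (cP t x₀ hx₀ hfit).W ↔ p.src ∈ DeepS t x₀ 0 := by
  classical
  simp [cP, DeepP]

/-- the site chart of `cS` is `eS`. [cite: Balaban1984PropagatorsII, p.238–239 (T_□ = □̃³; operators on T_□ «as in (2.19)»), dictionary] -/
@[simp] theorem cS_e : (cS t x₀ hx₀ hfit).e = eS (m := m) (K := K) t x₀ := rfl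
/-- the bond chart of `cB` is `eB`. [cite: Balaban1984PropagatorsII, p.238–239 (T_□ = □̃³; operators on T_□ «as in (2.19)»), dictionary] -/
@[simp] theorem cB_e : (cB t x₀ hx₀ hfit).e = eB (m := m) (K := K) t x₀ := rfl
/-- the plaquette chart of `cP` is `eP`. [cite: Balaban1984PropagatorsII, p.238–239 (T_□ = □̃³; operators on T_□ «as in (2.19)»), dictionary] -/
@[simp] theorem cP_e : (cP t x₀ hx₀ hfit).e = eP (m := m) (K := K) t x₀ := rfl

/-! ### The comparison lemmas: charted equalities of points are equalities of points -/

/-- `e y = e x ↔ y = x` for window points. [cite: Balaban1984PropagatorsII, p.238–239 (T_□ = □̃³; operators on T_□ «as in (2.19)»), dictionary] -/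
theorem eS_eq_iff {y x : Site (PV d ℓ m K hd hL) 0} (hy : y ∈ DeepS t x₀ 0) (hx : x ∈ DeepS t x₀ 0) :
    eS t x₀ y = eS t x₀ x ↔ y = x :=
  ⟨fun h => eS_injOn hy hx h, fun h => by rw [h]⟩

/-- `e y + e_κ = e x ↔ y + e_κ = x` for a window point `y` and a point `x` of margin `1` (additivity at `x`). [cite: Balaban1984PropagatorsII, p.238–239 (T_□ = □̃³; operators on T_□ «as in (2.19)»), dictionary] -/
theorem eS_shift_eq_iff (hx₀ : ∀ μ, 0 ≤ x₀ μ) {y x : Site (PV d ℓ m K hd hL) 0} (hy : y ∈ DeepS t x₀ 0)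
    (hx : x ∈ DeepS t x₀ 1) (κ : Fin (d + 1)) : (eS t x₀ y).shift κ = eS t x₀ x ↔ y.shift κ = x := by
  rw [shift_eq_iff, shift_eq_iff, ← eS_unshift hx₀ hx κ]
  exact eS_eq_iff hy (unshift_mem_deepS hx₀ hx κ).1

/-- `e y + e_κ = e x ↔ y + e_κ = x` for a point `y` of margin `1` and a window point `x` (additivity at `y`). [cite: Balaban1984PropagatorsII, p.238–239 (T_□ = □̃³; operators on T_□ «as in (2.19)»), dictionary] -/
theorem eS_shift_eq_iff' (hfit : ∀ μ, x₀ μ + (t.P.sitesPerDir 0 : ℕ) ≤ ((PV d ℓ m K hd hL).sitesPerDir 0 : ℕ))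
    {y x : Site (PV d ℓ m K hd hL) 0} (hy : y ∈ DeepS t x₀ 1) (hx : x ∈ DeepS t x₀ 0) (κ : Fin (d + 1)) :
    (eS t x₀ y).shift κ = eS t x₀ x ↔ y.shift κ = x := by
  rw [← eS_shift hfit hy κ]
  exact eS_eq_iff (shift_mem_deepS hfit hy κ).1 hx

/-! ### Kernels of the stencils -/

/-- the matrix of `∂` (sites → bonds): `∂(b, x) = c([b₊ = x] − [b₋ = x])`. [cite: Balaban1984PropagatorsII, (2.7) p.224; Balaban1984PropagatorsI, (1.4) p.18] -/
theorem toMatrix'_dE (P : Params) (c : ℝ) (b : PBond P 0) (x : Site P 0) :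
    LinearMap.toMatrix' (onFun (dE (P := P) c)) b x = c * ((if b.tgt = x then 1 else 0) - (if b.src = x then 1 else 0)) := by
  rw [LinearMap.toMatrix'_apply]
  show c • ((Pi.single x (1 : ℝ) : Site P 0 → ℝ) b.tgt - (Pi.single x (1 : ℝ) : Site P 0 → ℝ) b.src) = _
  rw [Pi.single_apply, Pi.single_apply, smul_eq_mul]

/-- the matrix of `∂` (bonds → plaquettes): `∂(p, b) = c([b = ⟨x,μ⟩] + [b = ⟨x+e_μ,ν⟩] − [b = ⟨x+e_ν,μ⟩] − [b = ⟨x,ν⟩])`, `p = p_{μν}(x)`.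
[cite: Balaban1984PropagatorsII, (2.5) p.224; Balaban1984PropagatorsI, (1.2) p.18] -/
theorem toMatrix'_dcE (P : Params) (c : ℝ) (p : Plaq P 0) (b : PBond P 0) :
    LinearMap.toMatrix' (onFun (dcE (P := P) c)) p b =
      c * ((if (⟨p.src, p.μ⟩ : PBond P 0) = b then 1 else 0) + (if (⟨p.src.shift p.μ, p.ν⟩ : PBond P 0) = b then 1 else 0)
        - (if (⟨p.src.shift p.ν, p.μ⟩ : PBond P 0) = b then 1 else 0) - (if (⟨p.src, p.ν⟩ : PBond P 0) = b then 1 else 0)) := by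
  rw [LinearMap.toMatrix'_apply]
  show c • ((Pi.single b (1 : ℝ) : PBond P 0 → ℝ) ⟨p.src, p.μ⟩ + (Pi.single b (1 : ℝ) : PBond P 0 → ℝ) ⟨p.src.shift p.μ, p.ν⟩
    - (Pi.single b (1 : ℝ) : PBond P 0 → ℝ) ⟨p.src.shift p.ν, p.μ⟩ - (Pi.single b (1 : ℝ) : PBond P 0 → ℝ) ⟨p.src, p.ν⟩) = _
  simp only [Pi.single_apply, smul_eq_mul]

/-- the matrix of `∂*` (bonds → sites) is the transpose of that of `∂`. [cite: Balaban1984PropagatorsII, (2.8) p.224] -/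
theorem toMatrix'_dsE (P : Params) (c : ℝ) :
    LinearMap.toMatrix' (onFun (dsE (P := P) c)) = (LinearMap.toMatrix' (onFun (dE (P := P) c)))ᵀ := by
  rw [dsE_eq_adjoint, toMatrix'_onFun_adjoint]

/-- the matrix of the plaquette `∂*` (plaquettes → bonds) is the transpose of that of `∂`. [cite: Balaban1984PropagatorsII, (2.19) p.226] -/
theorem toMatrix'_dcsE (P : Params) (c : ℝ) :
    LinearMap.toMatrix' (onFun (dcsE (P := P) c)) = (LinearMap.toMatrix' (onFun (dcE (P := P) c)))ᵀ := by
  rw [dcsE, toMatrix'_onFun_adjoint]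

/-! ### What a non-zero entry forces (the stencils have range one) -/

/-- a non-zero entry `∂(b, x)` forces `x ∈ {b₋, b₊}`. [cite: Balaban1984PropagatorsI, (1.2)–(1.4) p.18, (1.21) p.21 (stencils of range one), dictionary] -/
theorem dE_ne_zero_cases {P : Params} {c : ℝ} {b : PBond P 0} {x : Site P 0}
    (h : LinearMap.toMatrix' (onFun (dE (P := P) c)) b x ≠ 0) : b.tgt = x ∨ b.src = x := by
  by_contra hne
  push Not at hne
  rw [toMatrix'_dE, if_neg hne.1, if_neg hne.2, sub_zero, mul_zero] at h
  exact h rfl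

/-- a non-zero entry `∂(p, b)` forces `b` to be one of the four bonds of `∂p`. [cite: Balaban1984PropagatorsI, (1.2)–(1.4) p.18, (1.21) p.21 (stencils of range one), dictionary] -/
theorem dcE_ne_zero_cases {P : Params} {c : ℝ} {p : Plaq P 0} {b : PBond P 0}
    (h : LinearMap.toMatrix' (onFun (dcE (P := P) c)) p b ≠ 0) :
    (⟨p.src, p.μ⟩ : PBond P 0) = b ∨ (⟨p.src.shift p.μ, p.ν⟩ : PBond P 0) = b ∨
      (⟨p.src.shift p.ν, p.μ⟩ : PBond P 0) = b ∨ (⟨p.src, p.ν⟩ : PBond P 0) = b := by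
  by_contra hne
  push Not at hne
  obtain ⟨h1, h2, h3, h4⟩ := hne
  rw [toMatrix'_dcE, if_neg h1, if_neg h2, if_neg h3, if_neg h4] at h
  exact h (by ring)

/-- a bond is its initial point and its direction. [folklore] -/
private theorem mk_eq_iff {P : Params} {j : ℕ} (a : Site P j) (κ : Fin P.d) (b : PBond P j) :
    (⟨a, κ⟩ : PBond P j) = b ↔ a = b.src ∧ κ = b.dir := by
  cases b
  simp only [PBond.mk.injEq]

/-! ### `∂` on sites and `∂` on bonds AGREE through the charts on deep inputs (factor `c′/c`); their localities -/

/-- **`∂` (sites → bonds) of the global torus (factor `c′`) agrees with `∂` of `T_□` (factor `c`) through the window charts on the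
sites of margin `1`, with the unit factor `c′/c`.** [cite: Balaban1984PropagatorsII, (2.7) p.224, p.239 (operators on T_□ «as in (2.19)»), (2.94) p.239] -/
theorem kagree_dE (c' : ℝ) {c : ℝ} (hc : c ≠ 0) :
    KAgree (cS t x₀ hx₀ hfit) (cB t x₀ hx₀ hfit) (c' / c) (onFun (dE (P := PV d ℓ m K hd hL) c')) (onFun (dE (P := t.P) c))
      (DeepS t x₀ 1) := by
  intro x hx b
  have hx0 : x ∈ DeepS t x₀ 0 := deepS_mono (by omega) hx
  rw [toMatrix'_dE]
  by_cases hb : b ∈ (cB t x₀ hx₀ hfit).W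
  · have hbs : b.src ∈ DeepS t x₀ 0 := mem_cB_W.1 hb
    rw [if_pos hb, cS_e, cB_e, toMatrix'_dE]
    have e1 : (eB t x₀ b).tgt = eS t x₀ x ↔ b.tgt = x := eS_shift_eq_iff hx₀ hbs hx b.dir
    have e2 : (eB t x₀ b).src = eS t x₀ x ↔ b.src = x := eS_eq_iff hbs hx0
    rw [if_congr e1 rfl rfl, if_congr e2 rfl rfl]
    field_simp
  · rw [if_neg hb, mul_zero]
    have hbs : b.src ∉ DeepS t x₀ 0 := fun h => hb (mem_cB_W.2 h)
    have h1 : ¬ b.tgt = x := by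
      intro h
      have h' : b.src = x.unshift b.dir := (shift_eq_iff _ _ _).1 h
      exact hbs (h' ▸ (unshift_mem_deepS hx₀ hx _).1)
    have h2 : ¬ b.src = x := fun h => hbs (h ▸ hx0)
    rw [if_neg h1, if_neg h2, sub_zero, mul_zero]

/-- **`∂` (bonds → plaquettes) agrees through the window charts on the bonds of margin `1`, factor `c′/c`.**
[cite: Balaban1984PropagatorsII, (2.5) p.224, p.239 (operators on T_□), (2.94) p.239] -/
theorem kagree_dcE (c' : ℝ) {c : ℝ} (hc : c ≠ 0) :
    KAgree (cB t x₀ hx₀ hfit) (cP t x₀ hx₀ hfit) (c' / c) (onFun (dcE (P := PV d ℓ m K hd hL) c')) (onFun (dcE (P := t.P) c))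
      (DeepB t x₀ 1) := by
  intro b hb p
  have hb1 : b.src ∈ DeepS t x₀ 1 := hb
  have hb0 : b.src ∈ DeepS t x₀ 0 := deepS_mono (by omega) hb1
  rw [toMatrix'_dcE]
  by_cases hp : p ∈ (cP t x₀ hx₀ hfit).W
  · have hps : p.src ∈ DeepS t x₀ 0 := mem_cP_W.1 hp
    rw [if_pos hp, cB_e, cP_e, toMatrix'_dcE]
    have key : ∀ κ κ' : Fin (d + 1),
        (((⟨(eP t x₀ p).src, κ⟩ : PBond t.P 0) = eB t x₀ b ↔ (⟨p.src, κ⟩ : PBond (PV d ℓ m K hd hL) 0) = b) ∧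
        (((⟨(eP t x₀ p).src.shift κ, κ'⟩ : PBond t.P 0) = eB t x₀ b ↔
          (⟨p.src.shift κ, κ'⟩ : PBond (PV d ℓ m K hd hL) 0) = b))) := by
      intro κ κ'
      constructor
      · rw [mk_eq_iff, mk_eq_iff]
        exact and_congr (eS_eq_iff hps hb0) Iff.rfl
      · rw [mk_eq_iff, mk_eq_iff]
        exact and_congr (eS_shift_eq_iff hx₀ hps hb1 κ) Iff.rfl
    simp only [show (eP t x₀ p).μ = p.μ from rfl, show (eP t x₀ p).ν = p.ν from rfl]
    rw [if_congr (key p.μ p.ν).1 rfl rfl, if_congr (key p.μ p.ν).2 rfl rfl, if_congr (key p.ν p.μ).2 rfl rfl,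
      if_congr (key p.ν p.μ).1 rfl rfl]
    field_simp
  · rw [if_neg hp, mul_zero]
    have hps : p.src ∉ DeepS t x₀ 0 := fun h => hp (mem_cP_W.2 h)
    have hA : ∀ κ : Fin (d + 1), ¬ (⟨p.src, κ⟩ : PBond (PV d ℓ m K hd hL) 0) = b := by
      intro κ h
      exact hps (((mk_eq_iff _ _ _).1 h).1 ▸ hb0)
    have hB : ∀ κ κ' : Fin (d + 1), ¬ (⟨p.src.shift κ, κ'⟩ : PBond (PV d ℓ m K hd hL) 0) = b := by
      intro κ κ' h
      have h' : p.src = b.src.unshift κ := (shift_eq_iff _ _ _).1 ((mk_eq_iff _ _ _).1 h).1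
      exact hps (h' ▸ (unshift_mem_deepS hx₀ hb1 κ).1)
    rw [if_neg (hA _), if_neg (hB _ _), if_neg (hB _ _), if_neg (hA _)]
    ring

/-- locality of the global `∂` (sites → bonds): margin `r + 1` inputs give margin `r` outputs. [cite: Balaban1984PropagatorsI, (1.2)–(1.4) p.18, (1.21) p.21 (stencils of range one), dictionary] -/
theorem klocal_dE (hx₀ : ∀ μ, 0 ≤ x₀ μ) (c' : ℝ) (r : ℕ) :
    KLocal (onFun (dE (P := PV d ℓ m K hd hL) c')) (DeepS t x₀ (r + 1)) (DeepB t x₀ r) := by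
  intro x hx b hb
  rcases dE_ne_zero_cases hb with h | h
  · have h' : b.src = x.unshift b.dir := (shift_eq_iff _ _ _).1 h
    show b.src ∈ DeepS t x₀ r
    rw [h']
    exact (unshift_mem_deepS hx₀ hx _).1
  · show b.src ∈ DeepS t x₀ r
    rw [h]
    exact deepS_mono (by omega) hx

/-- locality of the global `∂*` (bonds → sites). [cite: Balaban1984PropagatorsI, (1.2)–(1.4) p.18, (1.21) p.21 (stencils of range one), dictionary] -/
theorem klocal_dsE (hfit : ∀ μ, x₀ μ + (t.P.sitesPerDir 0 : ℕ) ≤ ((PV d ℓ m K hd hL).sitesPerDir 0 : ℕ)) (c' : ℝ) (r : ℕ) :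
    KLocal (onFun (dsE (P := PV d ℓ m K hd hL) c')) (DeepB t x₀ (r + 1)) (DeepS t x₀ r) := by
  intro b hb x hx
  rw [toMatrix'_dsE, Matrix.transpose_apply] at hx
  have hb1 : b.src ∈ DeepS t x₀ (r + 1) := hb
  rcases dE_ne_zero_cases hx with h | h
  · rw [← h]
    exact (shift_mem_deepS hfit hb1 _).1
  · rw [← h]
    exact deepS_mono (by omega) hb1

/-- locality of the global `∂` (bonds → plaquettes). [cite: Balaban1984PropagatorsI, (1.2)–(1.4) p.18, (1.21) p.21 (stencils of range one), dictionary] -/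
theorem klocal_dcE (hx₀ : ∀ μ, 0 ≤ x₀ μ) (c' : ℝ) (r : ℕ) :
    KLocal (onFun (dcE (P := PV d ℓ m K hd hL) c')) (DeepB t x₀ (r + 1)) (DeepP t x₀ r) := by
  intro b hb p hp
  have hb1 : b.src ∈ DeepS t x₀ (r + 1) := hb
  show p.src ∈ DeepS t x₀ r
  rcases dcE_ne_zero_cases hp with h | h | h | h
  · rw [((mk_eq_iff _ _ _).1 h).1]; exact deepS_mono (by omega) hb1
  · rw [(shift_eq_iff _ _ _).1 ((mk_eq_iff _ _ _).1 h).1]; exact (unshift_mem_deepS hx₀ hb1 _).1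
  · rw [(shift_eq_iff _ _ _).1 ((mk_eq_iff _ _ _).1 h).1]; exact (unshift_mem_deepS hx₀ hb1 _).1
  · rw [((mk_eq_iff _ _ _).1 h).1]; exact deepS_mono (by omega) hb1

/-- locality of the global plaquette `∂*` (plaquettes → bonds). [cite: Balaban1984PropagatorsI, (1.2)–(1.4) p.18, (1.21) p.21 (stencils of range one), dictionary] -/
theorem klocal_dcsE (hfit : ∀ μ, x₀ μ + (t.P.sitesPerDir 0 : ℕ) ≤ ((PV d ℓ m K hd hL).sitesPerDir 0 : ℕ)) (c' : ℝ) (r : ℕ) :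
    KLocal (onFun (dcsE (P := PV d ℓ m K hd hL) c')) (DeepP t x₀ (r + 1)) (DeepB t x₀ r) := by
  intro p hp b hb
  rw [toMatrix'_dcsE, Matrix.transpose_apply] at hb
  have hp1 : p.src ∈ DeepS t x₀ (r + 1) := hp
  show b.src ∈ DeepS t x₀ r
  rcases dcE_ne_zero_cases hb with h | h | h | h
  · rw [← ((mk_eq_iff _ _ _).1 h).1]; exact deepS_mono (by omega) hp1
  · rw [← ((mk_eq_iff _ _ _).1 h).1]; exact (shift_mem_deepS hfit hp1 _).1
  · rw [← ((mk_eq_iff _ _ _).1 h).1]; exact (shift_mem_deepS hfit hp1 _).1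
  · rw [← ((mk_eq_iff _ _ _).1 h).1]; exact deepS_mono (by omega) hp1

/-! ### The adjoints `∂*` (bonds → sites) and `∂*` (plaquettes → bonds) AGREE through the charts, by transposition -/

/-- **`∂*` (bonds → sites) agrees through the window charts on the bonds of margin `2`, factor `c′/c`** (transpose of `kagree_dE`).
[cite: Balaban1984PropagatorsII, (2.8) p.224, p.239 (operators on T_□), (2.94) p.239] -/
theorem kagree_dsE (c' : ℝ) {c : ℝ} (hc : c ≠ 0) :
    KAgree (cB t x₀ hx₀ hfit) (cS t x₀ hx₀ hfit) (c' / c) (onFun (dsE (P := PV d ℓ m K hd hL) c')) (onFun (dsE (P := t.P) c))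
      (DeepB t x₀ 2) := by
  refine KAgree.transpose (kagree_dE c' hc) (fun x hx => ?_) (fun b hb => ?_) (fun b hb x hx => ?_)
    (fun b hb x hxW hxR => ?_) (toMatrix'_dsE _ c') (toMatrix'_dsE _ c)
  · exact Finset.mem_coe.2 (mem_cS_W.2 (deepS_mono (by omega) hx))
  · exact Finset.mem_coe.2 (mem_cB_W.2 (deepS_mono (by omega) (show b.src ∈ DeepS t x₀ 2 from hb)))
  · have hb2 : b.src ∈ DeepS t x₀ 2 := hb
    rcases dE_ne_zero_cases hx with h | h
    · rw [← h]; exact (shift_mem_deepS hfit (deepS_mono (by omega) hb2) _).1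
    · rw [← h]; exact deepS_mono (by omega) hb2
  · have hb2 : b.src ∈ DeepS t x₀ 2 := hb
    have hb1 : b.src ∈ DeepS t x₀ 1 := deepS_mono (by omega) hb2
    have hb0 : b.src ∈ DeepS t x₀ 0 := deepS_mono (by omega) hb2
    have hxW' : x ∈ DeepS t x₀ 0 := mem_cS_W.1 hxW
    rw [cS_e, cB_e]
    by_contra hne
    rcases dE_ne_zero_cases hne with h | h
    · have h' : b.src.shift b.dir = x := (eS_shift_eq_iff' hfit hb1 hxW' b.dir).1 h
      exact hxR (h' ▸ (shift_mem_deepS hfit hb2 _).1)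
    · have h' : b.src = x := (eS_eq_iff hb0 hxW').1 h
      exact hxR (h' ▸ hb1)

/-- **the plaquette `∂*` (plaquettes → bonds) agrees through the window charts on the plaquettes of margin `2`, factor `c′/c`**
(transpose of `kagree_dcE`; `∂*` is DEFINED as the adjoint, `B6SectAOperatorsV1.dcsE`). [cite: Balaban1984PropagatorsII, (2.19) p.226, p.239 (operators on T_□), (2.94) p.239] -/
theorem kagree_dcsE (c' : ℝ) {c : ℝ} (hc : c ≠ 0) :
    KAgree (cP t x₀ hx₀ hfit) (cB t x₀ hx₀ hfit) (c' / c) (onFun (dcsE (P := PV d ℓ m K hd hL) c')) (onFun (dcsE (P := t.P) c))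
      (DeepP t x₀ 2) := by
  refine KAgree.transpose (kagree_dcE c' hc) (fun b hb => ?_) (fun p hp => ?_) (fun p hp b hb => ?_)
    (fun p hp b hbW hbR => ?_) (toMatrix'_dcsE _ c') (toMatrix'_dcsE _ c)
  · exact Finset.mem_coe.2 (mem_cB_W.2 (deepS_mono (by omega) (show b.src ∈ DeepS t x₀ 1 from hb)))
  · exact Finset.mem_coe.2 (mem_cP_W.2 (deepS_mono (by omega) (show p.src ∈ DeepS t x₀ 2 from hp)))
  · have hp2 : p.src ∈ DeepS t x₀ 2 := hp
    have hp1 : p.src ∈ DeepS t x₀ 1 := deepS_mono (by omega) hp2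
    show b.src ∈ DeepS t x₀ 1
    rcases dcE_ne_zero_cases hb with h | h | h | h
    · rw [← ((mk_eq_iff _ _ _).1 h).1]; exact hp1
    · rw [← ((mk_eq_iff _ _ _).1 h).1]; exact (shift_mem_deepS hfit hp2 _).1
    · rw [← ((mk_eq_iff _ _ _).1 h).1]; exact (shift_mem_deepS hfit hp2 _).1
    · rw [← ((mk_eq_iff _ _ _).1 h).1]; exact hp1
  · have hp2 : p.src ∈ DeepS t x₀ 2 := hp
    have hp1 : p.src ∈ DeepS t x₀ 1 := deepS_mono (by omega) hp2
    have hp0 : p.src ∈ DeepS t x₀ 0 := deepS_mono (by omega) hp2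
    have hbW' : b.src ∈ DeepS t x₀ 0 := mem_cB_W.1 hbW
    rw [cP_e, cB_e]
    by_contra hne
    apply hbR
    show b.src ∈ DeepS t x₀ 1
    rcases dcE_ne_zero_cases hne with h | h | h | h
    · have h1 : eS t x₀ p.src = eS t x₀ b.src := ((mk_eq_iff _ _ _).1 h).1
      rw [← (eS_eq_iff hp0 hbW').1 h1]; exact hp1
    · have h1 : (eS t x₀ p.src).shift p.μ = eS t x₀ b.src := ((mk_eq_iff _ _ _).1 h).1
      rw [← (eS_shift_eq_iff' hfit hp1 hbW' _).1 h1]; exact (shift_mem_deepS hfit hp2 _).1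
    · have h1 : (eS t x₀ p.src).shift p.ν = eS t x₀ b.src := ((mk_eq_iff _ _ _).1 h).1
      rw [← (eS_shift_eq_iff' hfit hp1 hbW' _).1 h1]; exact (shift_mem_deepS hfit hp2 _).1
    · have h1 : eS t x₀ p.src = eS t x₀ b.src := ((mk_eq_iff _ _ _).1 h).1
      rw [← (eS_eq_iff hp0 hbW').1 h1]; exact hp1

end Stencils

/-! ## §5  `Δ = ∂*∂ + ∂∂*` ON VECTOR FIELDS — the local part of `Δ_a` without the averaging term — AGREES THROUGH THE WINDOW CHART:
`Δ^{(c′)}·h = (c′/c)²•(εΔ_□^{(c)}ρ)·h` for every `h` supported on bonds of margin `3` -/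

section LapV

open B6Prop25TwoScaleCensus (TSIdx)
open B6GlobalChartV1 (PV GlV1 toBox)
open B6SectAOperatorsV1 (dE dsE dcE dcsE)
open B6Ineq2133TwoScaleV1 (onFun)
open B6Prop26ReachTransplant (chartBond)
open B6MultiLevelBoxOperator (N0)

variable {d ℓ : ℕ} {hd : 1 ≤ d + 1} {hL : Odd (ℓ + 1) ∧ 1 < ℓ + 1} {a₀ a₁ : ℝ} {m K : ℕ}
variable {t : TSIdx d (ℓ + 1) hd hL a₀ a₁} {x₀ : Fin (d + 1) → ℤ}
variable {hx₀ : ∀ μ, 0 ≤ x₀ μ} {hfit : ∀ μ, x₀ μ + (t.P.sitesPerDir 0 : ℕ) ≤ ((PV d ℓ m K hd hL).sitesPerDir 0 : ℕ)}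

/-- **KERNEL AGREEMENT OF `Δ = ∂*∂ + ∂∂*` (vector fields)** through the bond window chart on the bonds of margin `3`, factor `(c′/c)²`
(the two products `∂*∘∂` (via plaquettes) and `∂∘∂*` (via sites) composed from §4). [cite: Balaban1984PropagatorsII, (2.19) p.226, (2.90) p.239, (2.94) p.239] -/
theorem kagree_lapV {c' : ℝ} (hc' : c' ≠ 0) {c : ℝ} (hc : c ≠ 0) :
    KAgree (cB t x₀ hx₀ hfit) (cB t x₀ hx₀ hfit) (c' / c * (c' / c))
      (onFun (dcsE (P := PV d ℓ m K hd hL) c' ∘ₗ dcE c' + dE c' ∘ₗ dsE c'))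
      (onFun (dcsE (P := t.P) c ∘ₗ dcE c + dE c ∘ₗ dsE c)) (DeepB t x₀ 3) := by
  rw [onFun_add, onFun_add, onFun_comp, onFun_comp, onFun_comp, onFun_comp]
  refine KAgree.add ?_ ?_
  · exact KAgree.comp ((kagree_dcE c' hc).mono fun b hb => deepS_mono (by omega) hb) (div_ne_zero hc' hc)
      (klocal_dcE hx₀ c' 2) (kagree_dcsE c' hc)
  · exact KAgree.comp ((kagree_dsE c' hc).mono fun b hb => deepS_mono (by omega) hb) (div_ne_zero hc' hc)
      (klocal_dsE hfit c' 2) ((kagree_dE c' hc).mono (deepS_mono (by omega)))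

/-- **`Δ·h = (c′/c)²•(εΔ_□ρ)·h`**: the vector Laplacian `∂*∂ + ∂∂*` of the global torus (lattice factor `c′`), cut off by any `h` supported
on the bonds of margin `3` of the window, IS the transplanted vector Laplacian of the member torus `T_□` (factor `c`) up to the unit factor
`(c′/c)²` — the `Δ`-part of *"On this torus we define operators R, Δ_a as in (2.17), (2.19)"* (p. 239) read back on `T_η` near `□`, with the
rescaling (2.94). [cite: Balaban1984PropagatorsII, (2.19) p.226, p.239 (T_□), (2.90)–(2.91) p.239, (2.94) p.239] -/
theorem agree_lapV {c' : ℝ} (hc' : c' ≠ 0) {c : ℝ} (hc : c ≠ 0) (h : PBond (PV d ℓ m K hd hL) 0 → ℝ)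
    (hh : ∀ b, h b ≠ 0 → b ∈ DeepB t x₀ 3) :
    onFun (dcsE (P := PV d ℓ m K hd hL) c' ∘ₗ dcE c' + dE c' ∘ₗ dsE c') * mulOp h =
      (c' / c) ^ 2 • (transplant (cB t x₀ hx₀ hfit).W (eB t x₀) (onFun (dcsE (P := t.P) c ∘ₗ dcE c + dE c ∘ₗ dsE c)) * mulOp h) := by
  rw [sq]
  exact (kagree_lapV hc' hc).mul_mulOp (fun b hb => Finset.mem_coe.2 (mem_cB_W.2 (deepS_mono (by omega) hb))) h hh

/-- the member's `Δ` on vector fields IS the V1 formula `∂*∂ + ∂∂*` at the member's fine factor `c = L^j` (`B6SectCTwoScaleV1Lattice.tsV1`). [cite: Balaban1984PropagatorsII, (2.19) p.226, (2.90) p.239] -/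
theorem lapV_member (t : TSIdx d (ℓ + 1) hd hL a₀ a₁) :
    t.D.lapV = dcsE (P := t.P) ((((ℓ + 1 : ℕ) : ℝ)) ^ t.j) ∘ₗ dcE ((((ℓ + 1 : ℕ) : ℝ)) ^ t.j) +
      dE ((((ℓ + 1 : ℕ) : ℝ)) ^ t.j) ∘ₗ dsE ((((ℓ + 1 : ℕ) : ℝ)) ^ t.j) := rfl

/-- on the bond window, the chart `eB` IS `chartBond t (labels) dir x₀`, so transplants along `eB` are the `GlV1`-type transplants of
`B6GlobalChartV1`. [cite: Balaban1984PropagatorsII, p.238 (T_□), dictionary] -/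
theorem transplant_eB_eq (T' : Module.End ℝ (PBond t.P 0 → ℝ)) :
    transplant (cB t x₀ hx₀ hfit).W (eB t x₀) T' = transplant (cB t x₀ hx₀ hfit).W (chartBond t posV PBond.dir x₀) T' :=
  transplant_congr _ (fun _ hb => eB_eq_chartBond ((mem_cB_W (hx₀ := hx₀) (hfit := hfit)).1 hb)) T'

/-- `GlV1` (the transplanted `G_□` of `B6GlobalChartV1`, charted by `toBox` labels) on the full bond window IS the transplant along `eB`.
[cite: Balaban1984PropagatorsII, (2.90)–(2.91) p.239, dictionary] -/
theorem GlV1_eq {Mh k : ℕ} {P' : Fin (d + 1) → ℕ} (hN : ∀ μ, N0 ℓ Mh k P' μ = (PV d ℓ m K hd hL).sitesPerDir 0) :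
    GlV1 t hN (cB t x₀ hx₀ hfit).W x₀ = transplant (cB t x₀ hx₀ hfit).W (eB t x₀) (onFun t.D.G) := by
  rw [transplant_eB_eq]
  rfl

/-- **THE `Δ`-PART OF `hagree` IN THE SHAPE OF `B6GlobalChartV1.prop26_2136_V1_of_2134_eq291`**: with the member's own `Δ_□ = t.D.lapV`
(fine factor `L^j`) transplanted along `chartBond` on the full window. [cite: Balaban1984PropagatorsII, (2.90)–(2.91) p.239, (2.94) p.239] -/
theorem agree_lapV_member {c' : ℝ} (hc' : c' ≠ 0) (h : PBond (PV d ℓ m K hd hL) 0 → ℝ) (hh : ∀ b, h b ≠ 0 → b ∈ DeepB t x₀ 3) :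
    onFun (dcsE (P := PV d ℓ m K hd hL) c' ∘ₗ dcE c' + dE c' ∘ₗ dsE c') * mulOp h =
      (c' / (((ℓ + 1 : ℕ) : ℝ) ^ t.j)) ^ 2 •
        (transplant (cB t x₀ hx₀ hfit).W (chartBond t posV PBond.dir x₀) (onFun t.D.lapV) * mulOp h) := by
  rw [← transplant_eB_eq, lapV_member]
  exact agree_lapV hc' t.hc h hh

end LapV

/-! ## §6  The two cheap hypotheses of `prop26_2136_V1_of_2134_eq291` DISCHARGED: the splitting `Δ_a = M − ∂P∂*` of the V1 model operator
(`hΔ`) and the inversion `(M_□ − P_□)G_□h_□ = h_□` for the transplanted genuine two-scale member (`hinvl`) -/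

section Discharges

open B6Prop25TwoScaleCensus (TSIdx)
open B6GlobalChartV1 (PV GlV1)
open B6SectAOperatorsV1 (dE dsE dcE dcsE QE QsE aE RE)
open B6SectAVectorModelV1 (deltaAE deltaAE_def)
open B6SectADomainsV1 (Domains)
open B6Ineq2133TwoScaleV1 (onFun)
open B6Prop26ReachTransplant (chartBond transplant_inv_mul_mulOp transplant_sub)
open B6Eq2129TwoScaleV1 (deltaA_comp_G_V1)
open B6MultiLevelBoxOperator (N0)

/-- **`hΔ` DISCHARGED — the splitting `Δ_a = M − ∂P∂*` of p21's model operator (2.19)**: `deltaAE = (∂*∂ + ∂∂* + Q*aQ) − ∂(I − R)∂*` read on bond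
functions (`P = I − R`, (2.17)); the first bracket is the LOCAL PART `M`, the subtrahend the non-local `∂P∂*` (the `Dg` of `B6Eq291Generator.kFam`).
[cite: Balaban1984PropagatorsII, (2.17) p.226, (2.19) p.226] -/
theorem deltaAE_split {P : Params} (Dm : Domains P) (c : ℝ) (w : B6SectAOperatorsV1.BondIdx Dm → ℝ) :
    onFun (deltaAE Dm c w) =
      onFun (dcsE c ∘ₗ dcE c + dE c ∘ₗ dsE c + QsE Dm ∘ₗ aE Dm w ∘ₗ QE Dm) - onFun (dE c ∘ₗ (LinearMap.id - RE Dm c) ∘ₗ dsE c) := by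
  rw [deltaAE_def, ← onFun_sub]
  congr 1
  simp only [LinearMap.comp_sub, LinearMap.sub_comp, LinearMap.id_comp]
  abel

variable {d ℓ : ℕ} {hd : 1 ≤ d + 1} {hL : Odd (ℓ + 1) ∧ 1 < ℓ + 1} {a₀ a₁ : ℝ} {m K : ℕ}
variable {t : TSIdx d (ℓ + 1) hd hL a₀ a₁} {x₀ : Fin (d + 1) → ℤ}
variable {hx₀ : ∀ μ, 0 ≤ x₀ μ} {hfit : ∀ μ, x₀ μ + (t.P.sitesPerDir 0 : ℕ) ≤ ((PV d ℓ m K hd hL).sitesPerDir 0 : ℕ)}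

/-- the member's `Δ_a` (2.90) splits as `(Δ + Q*aQ) − ∂P_□∂*` (`B6SectA.deltaA` unfolded). [cite: Balaban1984PropagatorsII, (2.19) p.226, (2.90) p.239] -/
theorem deltaA_member (t : TSIdx d (ℓ + 1) hd hL a₀ a₁) :
    t.D.deltaA = (t.D.lapV + LinearMap.adjoint t.D.Q ∘ₗ t.D.a ∘ₗ t.D.Q) - t.D.grad ∘ₗ t.D.P ∘ₗ t.D.dv := by
  show t.D.lapV - t.D.grad ∘ₗ t.D.P ∘ₗ t.D.dv + LinearMap.adjoint t.D.Q ∘ₗ t.D.a ∘ₗ t.D.Q = _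
  abel

/-- `Δ_□G_□ = 1` on `T_□` for the genuine two-scale member, read on bond functions. [cite: Balaban1984PropagatorsII, (2.22) p.226, (2.90) p.239] -/
theorem onFun_deltaA_mul_G (ha₀ : 0 < a₀) (t : TSIdx d (ℓ + 1) hd hL a₀ a₁) :
    (onFun (t.D.lapV + LinearMap.adjoint t.D.Q ∘ₗ t.D.a ∘ₗ t.D.Q) - onFun (t.D.grad ∘ₗ t.D.P ∘ₗ t.D.dv)) * onFun t.D.G = 1 := by
  have hDG : t.D.deltaA ∘ₗ t.D.G = LinearMap.id := deltaA_comp_G_V1 t.hc t.hjP t.Λ' (t.w_pos ha₀)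
  rw [← onFun_sub, ← deltaA_member, Module.End.mul_eq_comp, ← onFun_comp, hDG]
  rfl

/-- **`hinvl` DISCHARGED FOR THE TRANSPLANTED GENUINE TWO-SCALE MEMBER**: with `M_□ := ε(Δ_□ + Q*aQ)ρ`, `P_□ := ε(∂P_□∂*)ρ` (the member's own
operators of (2.90) transplanted along the bijective bond window chart) and `G_□ := εG_□ρ`, for every `h_□` supported in the window
`(M_□ − P_□)·G_□·h_□ = h_□` — from `Δ_□G_□ = 1` on `T_□` (`B6Eq2129TwoScaleV1.deltaA_comp_G_V1`) and the multiplicativity of the bijective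
transplant (`B6Prop26ReachTransplant.transplant_inv_mul_mulOp`). [cite: Balaban1984PropagatorsII, (2.90)–(2.91) p.239, p.238 (T_□ = □̃³)] -/
theorem hinvl_member (ha₀ : 0 < a₀) (h : PBond (PV d ℓ m K hd hL) 0 → ℝ) (hh : ∀ b, h b ≠ 0 → b ∈ (cB t x₀ hx₀ hfit).W) :
    (transplant (cB t x₀ hx₀ hfit).W (eB t x₀) (onFun (t.D.lapV + LinearMap.adjoint t.D.Q ∘ₗ t.D.a ∘ₗ t.D.Q)) -
        transplant (cB t x₀ hx₀ hfit).W (eB t x₀) (onFun (t.D.grad ∘ₗ t.D.P ∘ₗ t.D.dv))) *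
      transplant (cB t x₀ hx₀ hfit).W (eB t x₀) (onFun t.D.G) * mulOp h = mulOp h := by
  rw [← transplant_sub]
  exact transplant_inv_mul_mulOp (cB t x₀ hx₀ hfit).inj (cB t x₀ hx₀ hfit).surj (onFun_deltaA_mul_G ha₀ t) h hh

/-- the same in the `GlV1`/`chartBond` vocabulary of `B6GlobalChartV1.prop26_2136_V1_of_2134_eq291` (its hypothesis `hinvl`, literally, for
`Ml := ε(Δ_□ + Q*aQ)ρ`, `Pl := ε(∂P_□∂*)ρ` along `chartBond` on the full window). [cite: Balaban1984PropagatorsII, (2.90)–(2.91) p.239] -/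
theorem hinvl_GlV1 (ha₀ : 0 < a₀) {Mh k : ℕ} {P' : Fin (d + 1) → ℕ} (hN : ∀ μ, N0 ℓ Mh k P' μ = (PV d ℓ m K hd hL).sitesPerDir 0)
    (h : PBond (PV d ℓ m K hd hL) 0 → ℝ) (hh : ∀ b, h b ≠ 0 → b ∈ (cB t x₀ hx₀ hfit).W) :
    (transplant (cB t x₀ hx₀ hfit).W (chartBond t posV PBond.dir x₀) (onFun (t.D.lapV + LinearMap.adjoint t.D.Q ∘ₗ t.D.a ∘ₗ t.D.Q)) -
        transplant (cB t x₀ hx₀ hfit).W (chartBond t posV PBond.dir x₀) (onFun (t.D.grad ∘ₗ t.D.P ∘ₗ t.D.dv))) *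
      GlV1 t hN (cB t x₀ hx₀ hfit).W x₀ * mulOp h = mulOp h := by
  rw [GlV1_eq, ← transplant_eB_eq, ← transplant_eB_eq]
  exact hinvl_member ha₀ h hh

end Discharges

end Literature.MathematicalPhysics.QuantumFieldTheory.Balaban1983to89.B6AgreeLapV1Chart

end
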